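import Literature.Computability.Complexity.LundEtAl1992
import Literature.Computability.Complexity.SumcheckMAReferee
import Literature.Computability.Complexity.SumcheckMAGame
import Literature.Computability.Complexity.CookReducibilityTransitive
import Literature.Computability.Complexity.CountingReductions
import Literature.Computability.Complexity.CodeFPListKit
import Literature.Computability.Complexity.CodeFPStrings
import Literature.Computability.Complexity.ArthurMerlinGamesIPProofs
import Literature.Computability.Complexity.UniformProbBlocks
import Literature.Computability.Complexity.ParsimoniousCookLevin
import Literature.Computability.Complexity.ParsimoniousThreeCNFMachine
import Literature.Computability.Complexity.CountingHierarchyProofs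
import Literature.Computability.Complexity.FinitePatching
import HarnessLib

/-!
# `P^{#P} ⊆ IP`: proof of Lund–Fortnow–Karloff–Nisan's Theorem 1 (`LundEtAl1992_thm1_holds`)

Sibling proof file of `LundEtAl1992.lean` (D-0014): the named fact `LundEtAl1992_thm1 : PSharpP ⊆ IP`
— Lund, Fortnow, Karloff, Nisan, *Algebraic methods for interactive proof systems*, J. ACM 39 (1992),
**Theorem 1** (p. 861): "Every language in `P^{#P}` has an interactive proof system" — is PROVED here
over the tree's classes (`PSharpP = ⋃_{f ∈ #P} P^f` of `Counting.lean`, the transcript model of oracle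
machines of `Oracle.lean`; `IP` of `InteractiveProofs.lean`: private-coin verifiers with `next ∈ FP`,
`verdict ∈ P`, `|x|^c` messages, completeness `2/3`, soundness `1/3` against all provers).

## The printed proof and the proof formalised

LFKN prove Theorem 1 in two steps. **Lemma 3** (p. 861): if the graph of ONE `#P`-complete function
has an interactive proof then every `L' ∈ P^{#P}` has one — "we can reduce the membership problem for
`L'` to that of verifying" values of the complete function; "Given an interactive proof system for `L`,
it is easy to construct one for `L'`" (the prover supplies the oracle answers, each is then verified).
**§3**: the protocol for the permanent of `0–1` matrices (complete by Valiant's theorem), in which the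
prover sends the coefficients of a low-degree polynomial, the verifier checks it against the current
claims and continues with its value at a random point (Lemma 4: two distinct polynomials of degree `≤ r`
agree on at most `r` points).

The tree does not have Valiant's permanent theorem, but it PROVES the parsimonious `#P`-completeness of
`#SAT` (`parsimoniousReducible_SHARPSAT`, `ParsimoniousCookLevin.lean`) and the deterministic core of the
same expand/shrink technique for `#SAT` — the sumcheck protocol of Arora–Barak's Thm. 8.21 (the textbook
form of LFKN's protocol) over `ℤ`: `Sumcheck.soundness`, `Sumcheck.completeness` (`SumcheckCNF.lean`),
with the fixed-width message format and the polynomial-time pieces of the verifier built for its `MA`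
simulation (`SumcheckMASpec.lean`, `SumcheckMAReferee.lean`). So the complete function used here is
`#SAT`, and the interactive proof for `L ∈ P^f` (`f ∈ #P`, `M` the polynomial-time oracle algorithm) is
the following PUBLIC-COIN protocol with `|x|^c` messages of a common length `m(|x|)`:

* the verifier's messages are fresh blocks of its coins (Arthur; the verifier `AMasIP.nextF` /
  `AMasIP.verdictL` of `ArthurMerlinGamesIPProofs.lean`, here with polynomially many messages:
  `LFKN.pubVerifier`, whose interaction with any prover is the prefix-closed public transcript
  `LFKN.pubT`, `LFKN.transcript_eq_pubT`, `LFKN.accepts_iff`);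
* message `1` of the prover is the list of CLAIMED ORACLE ANSWERS; the referee replays `M` on `x` with
  them (query `i` is `qryOf M x (ans ↾ i)`), requiring queries of legal length and final acceptance
  (`LFKN.replayOK`) — if all claims are true the replay is the true run (`LFKN.eq_true_of_run_of_answers`),
  so for `x ∉ L` some claim `f(yᵢ) = Kᵢ` is false (Lemma 3);
* claim `i` is `#SAT(φᵢ) = Kᵢ` for `φᵢ = red yᵢ` (`red` the parsimonious reduction) and is checked by
  the sumcheck protocol in the round slots `u = iN, …` (prover polynomial in message `2u+3`, challenge =
  the first `ℓ` bits of the verifier block `2u+4`): `LFKN.instCheck` ↔ `Sumcheck.Accepts`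
  (`LFKN.instCheck_eq_true_iff`), the whole test `LFKN.refCore`, computed in polynomial time
  (`LFKN.refCoreC`, an assembly of `CodeFP` combinators; `LFKN.Ref_mem_P`);
* soundness (`LFKN.acceptProb_le_third`): an accepted transcript of `x ∉ L` has a round whose challenge
  is a root of the nonzero difference polynomial of degree `≤ N` (`LFKN.exists_badRound_of_refCore`,
  `Sumcheck.soundness`), i.e. a coin block in a small bad set determined by the EARLIER coins
  (`LFKN.exists_badBlock_of_refCore`, `LFKN.uniformProb_badSetIP_le`: `≤ N/2^ℓ`); fresh coins and the
  union bound (`uniformProb_exists_badBlock_le`) give `≤ (n^c + 1) N / 2^ℓ ≤ 1/8` for `ℓ = n^c + N + 3`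
  (LFKN (2): "less than `N²` times the minuscule probability");
* completeness (`LFKN.exists_acceptProb_eq_one`): the honest prover (`LFKN.honestProver`: true answers,
  then the fixed-width codes of the honest polynomials `h`) is accepted on every coin string
  (`LFKN.refCore_pubT_honestProver`, `Sumcheck.completeness`; LFKN (1): "Pr[Vanna accepts] = 1");
* inputs shorter than a constant `n₀` (for which `n^c` messages do not suffice) are decided by the
  referee itself (`LFKN.Ref`, a `caseSplit` with a finite table).

`LFKN.PSharpP_subset_IP` assembles the inclusion and `LundEtAl1992_thm1_holds` discharges the fact.
No new definitions of complexity notions are introduced; everything in namespace `LFKN` is protocol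
bookkeeping.

## References

* C. Lund, L. Fortnow, H. Karloff, N. Nisan, *Algebraic methods for interactive proof systems*,
  J. ACM 39(4) (1992) 859–868: Thm. 1 and Lemma 3 (p. 861), §3 (the protocol; proof of Thm. 1, (1)–(2),
  pp. 862–863), Lemma 4.
* S. Arora, B. Barak, *Computational Complexity: A Modern Approach*, CUP 2009, §8.3.1–8.3.2, Thm. 8.21
  (sumcheck protocol for `#SAT_D`), §8.2.1 (public coins), §17.3.1 (the Cook–Levin reduction is
  parsimonious), §1.3 and §3.4 (polynomial time; oracle machines).
-/

noncomputable section

namespace Literature.Computability.Complexity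

open _root_.Computability Polynomial Brick Sumcheck SumcheckMA CodeFP Finset

namespace LFKN

/-! ### Transcript accessors -/

/-- The prover's polynomial message of global sumcheck round `u`: message `2u + 3` of the
transcript. [cite: LundEtAl1992, §3 (the prover sends the coefficients of a polynomial)] -/
def polyMsg (t : List (List Bool)) (u : ℕ) : List Bool := t.getD (2 * u + 3) []

/-- The verifier's challenge block of global round `u`: message `2u + 4` (sent AFTER the prover's
polynomial of that round). [cite: LundEtAl1992, §3 ("Vanna chooses a random `a`, sends it to Pat")] -/
def chalBlk (t : List (List Bool)) (u : ℕ) : List Bool := t.getD (2 * u + 4) []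

/-- The challenge of round `u`: the first `ℓ` bits of the block, read as a natural number.
[cite: AroraBarakCC2009, §8.3.2 ("pick a random number `a`")] -/
def chalVal (ℓ : ℕ) (t : List (List Bool)) (u : ℕ) : ℤ := (bitsToNat ((chalBlk t u).take ℓ) : ℤ)

/-- The challenges of the instance occupying the rounds `u₀, …, u₀ + k - 1`. [cite: AroraBarakCC2009, §8.3.2] -/
def chals (ℓ : ℕ) (t : List (List Bool)) (u₀ k : ℕ) : List ℤ := (List.range k).map fun j => chalVal ℓ t (u₀ + j)

/-- The prover's polynomial of round `u₀ + j`, decoded in width `W` with `D` coefficients (total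
decoding of any string). [cite: AroraBarakCC2009, Thm. 8.21 (proof: "the prover returns some `s(X₁)`")] -/
def stratIP (D W : ℕ) (t : List (List Bool)) (u₀ j : ℕ) : ℤ[X] := ofCoeffs (decodeCoeffs W D (polyMsg t (u₀ + j)))

/-- `chals` has length `k`. [folklore] -/
@[simp] theorem length_chals (ℓ : ℕ) (t : List (List Bool)) (u₀ k : ℕ) : (chals ℓ t u₀ k).length = k := by
  simp [chals]

/-- The `j`-th challenge. [folklore] -/
theorem getD_chals {ℓ : ℕ} {t : List (List Bool)} {u₀ k j : ℕ} (hj : j < k) :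
    (chals ℓ t u₀ k).getD j 0 = chalVal ℓ t (u₀ + j) := by
  unfold chals
  rw [List.getD_eq_getElem _ _ (by simpa using hj), List.getElem_map, List.getElem_range]

/-- Prefixes of the challenge list. [folklore] -/
theorem take_chals {ℓ : ℕ} {t : List (List Bool)} {u₀ k j : ℕ} (hj : j ≤ k) :
    (chals ℓ t u₀ k).take j = chals ℓ t u₀ j := by
  unfold chals
  rw [← List.map_take, List.take_range, min_eq_left hj]

/-- `stratIP` has degree `≤ D - 1`. [folklore] -/
theorem natDegree_stratIP_le (D W : ℕ) (t : List (List Bool)) (u₀ j : ℕ) : (stratIP D W t u₀ j).natDegree ≤ D - 1 := by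
  unfold stratIP
  simpa using natDegree_ofCoeffs_le (decodeCoeffs W D (polyMsg t (u₀ + j)))

/-- Challenges are in `[0, 2^ℓ)`. [folklore] -/
theorem chalVal_nonneg (ℓ : ℕ) (t : List (List Bool)) (u : ℕ) : 0 ≤ chalVal ℓ t u := by
  unfold chalVal; positivity

/-- Challenges are in `[0, 2^ℓ)`. [folklore] -/
theorem chalVal_lt (ℓ : ℕ) (t : List (List Bool)) (u : ℕ) : chalVal ℓ t u < 2 ^ ℓ := by
  unfold chalVal
  have h1 := bitsToNat_lt ((chalBlk t u).take ℓ)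
  have h2 : 2 ^ ((chalBlk t u).take ℓ).length ≤ 2 ^ ℓ :=
    Nat.pow_le_pow_right (by norm_num) (by rw [List.length_take]; exact min_le_left _ _)
  exact_mod_cast h1.trans_le h2

/-- Challenges have absolute value `≤ 2^ℓ`. [folklore] -/
theorem abs_le_of_mem_chals {ℓ : ℕ} {t : List (List Bool)} {u₀ k : ℕ} {x : ℤ} (hx : x ∈ chals ℓ t u₀ k) :
    |x| ≤ 2 ^ ℓ := by
  unfold chals at hx
  obtain ⟨j, -, rfl⟩ := List.mem_map.1 hx
  rw [abs_of_nonneg (chalVal_nonneg _ _ _)]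
  exact (chalVal_lt _ _ _).le

/-! ### One instance of the sumcheck protocol (AB Thm. 8.21) -/

/-- **One round of the verifier** for the instance starting at global round `u₀`, round `j`: decode
the prover's coefficient list, check `s(0) + s(1) = v` against the current claim `v`, and continue with
the claim `s(r_{u₀+j})`. [cite: AroraBarakCC2009, §8.3.2 (Sumcheck protocol: "Reject if `s(0)+s(1) ≠ K`; otherwise pick a random `a` … recursively")] -/
def roundStepIP (ℓ D W : ℕ) (t : List (List Bool)) (u₀ : ℕ) (st : ℤ × Bool) (j : ℕ) : ℤ × Bool :=
  let cs := decodeCoeffs W D (polyMsg t (u₀ + j))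
  (evalCoeffs cs (chalVal ℓ t (u₀ + j)), st.2 && decide (evalCoeffs cs 0 + evalCoeffs cs 1 = st.1))

/-- **`k` rounds** from the claim `K`, as a left fold. [cite: AroraBarakCC2009, §8.3.2 (Sumcheck protocol)] -/
def runRoundsIP (ℓ D W : ℕ) (t : List (List Bool)) (u₀ : ℕ) (K : ℤ) (k : ℕ) : ℤ × Bool :=
  (List.range k).foldl (roundStepIP ℓ D W t u₀) (K, true)

/-- **The test of one instance** `(φ, K)` ("`#SAT(φ) = K`") occupying the rounds from `u₀`: all
`|varList φ|` consistency checks pass and the final claim is `P_φ` at the challenges.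
[cite: AroraBarakCC2009, §8.3.2 (Sumcheck protocol)] -/
def instCheck (ℓ D W : ℕ) (t : List (List Bool)) (u₀ : ℕ) (φ : CNF ℕ) (K : ℤ) : Bool :=
  let vl := varList φ
  let st := runRoundsIP ℓ D W t u₀ K vl.length
  st.2 && decide (st.1 = cnfVal (lookupVal (vl.zip (chals ℓ t u₀ vl.length))) φ)

/-- **The fold invariant**: after `i ≤ k` rounds the claim is `Sumcheck.chain K s r i` for the decoded
strategy `s = stratIP` and the challenges `r = chals … k`, and the flag records the consistency checks of
the rounds `< i`. [cite: AroraBarakCC2009, Thm. 8.21 (proof)] -/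
theorem runRoundsIP_eq (ℓ D W : ℕ) (t : List (List Bool)) (u₀ : ℕ) (K : ℤ) (k : ℕ) : ∀ i ≤ k,
    runRoundsIP ℓ D W t u₀ K i =
      (chain K (stratIP D W t u₀) (chals ℓ t u₀ k) i,
        decide (∀ i' < i, (stratIP D W t u₀ i').eval 0 + (stratIP D W t u₀ i').eval 1 =
          chain K (stratIP D W t u₀) (chals ℓ t u₀ k) i'))
  | 0, _ => by simp [runRoundsIP]
  | i + 1, hi => by
    have ih := runRoundsIP_eq ℓ D W t u₀ K k i (Nat.le_of_succ_le hi)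
    have hi' : i < k := hi
    rw [runRoundsIP, List.range_succ, List.foldl_append, List.foldl_cons, List.foldl_nil, ← runRoundsIP, ih]
    unfold roundStepIP
    simp only
    refine Prod.ext ?_ ?_
    · simp only
      rw [chain_succ, getD_chals hi', evalCoeffs_eq]
      rfl
    · simp only
      rw [evalCoeffs_eq, evalCoeffs_eq]
      set s := stratIP D W t u₀ with hs
      set r := chals ℓ t u₀ k with hr
      have hsi : ofCoeffs (decodeCoeffs W D (polyMsg t (u₀ + i))) = s i := rfl
      rw [hsi]
      by_cases hall : ∀ i' < i, (s i').eval 0 + (s i').eval 1 = chain K s r i'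
      · rw [decide_eq_true hall, Bool.true_and]
        by_cases hlast : (s i).eval 0 + (s i).eval 1 = chain K s r i
        · rw [decide_eq_true hlast, decide_eq_true]
          intro i' hi''
          rcases Nat.lt_succ_iff_lt_or_eq.1 hi'' with hlt | rfl
          · exact hall i' hlt
          · exact hlast
        · rw [decide_eq_false hlast, decide_eq_false]
          exact fun h => hlast (h i (Nat.lt_succ_self i))
      · rw [decide_eq_false hall, Bool.false_and, decide_eq_false]
        exact fun h => hall fun i' hi'' => h i' (Nat.lt_succ_of_lt hi'')

/-- **The instance test is `Sumcheck.Accepts`** for the decoded strategy and the challenges.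
[cite: AroraBarakCC2009, Thm. 8.21 (proof)] -/
theorem instCheck_eq_true_iff (ℓ D W : ℕ) (t : List (List Bool)) (u₀ : ℕ) (φ : CNF ℕ) (K : ℤ) :
    instCheck ℓ D W t u₀ φ K = true ↔
      Sumcheck.Accepts φ (varList φ) K (stratIP D W t u₀) (chals ℓ t u₀ (varList φ).length) := by
  unfold instCheck
  simp only
  rw [runRoundsIP_eq ℓ D W t u₀ K _ _ le_rfl, Bool.and_eq_true, decide_eq_true_eq, decide_eq_true_eq]
  have hpt : cnfVal (lookupVal ((varList φ).zip (chals ℓ t u₀ (varList φ).length))) φ =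
      cnfVal (pt (varList φ) (chals ℓ t u₀ (varList φ).length)) φ := by
    congr 1
    funext v
    exact lookupVal_zip _ _ (by simp) v
  rw [hpt]
  rfl

/-! ### The full cube sum counts the satisfying assignments (AB (8.7)) -/

/-- **`H_φ(ε) = #SAT(φ)`** over the variable list `varList φ`: the sum of `P_φ` over the Boolean cube is
the number of satisfying assignments of the occurring variables (`CNF.numSat`).
[cite: AroraBarakCC2009, §8.3.2 ((8.7))] -/
theorem H_varList_nil_eq_numSat (φ : CNF ℕ) : H φ (varList φ) [] = (φ.numSat : ℤ) := by
  classical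
  rw [H_nil_eq_card, Nat.cast_inj]
  set vl := varList φ with hvl
  have hidx : ∀ v ∈ φ.vars, vl.idxOf v < vl.length := fun v hv =>
    List.idxOf_lt_length_iff.2 (mem_varList_iff_mem_vars.2 hv)
  -- the bijection: a tuple of bits for the listed variables ↦ the assignment of the occurring variables
  let e : (Fin vl.length → Bool) → (φ.vars → Bool) := fun b v => b ⟨vl.idxOf v.1, hidx v.1 v.2⟩
  have he_inj : Function.Injective e := by
    intro b b' hbb'
    funext i
    have hmem : vl.get i ∈ φ.vars := mem_varList_iff_mem_vars.1 (List.get_mem vl i)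
    have := congrFun hbb' ⟨vl.get i, hmem⟩
    simp only [e] at this
    have hi : (⟨vl.idxOf (vl.get i), hidx _ hmem⟩ : Fin vl.length) = i := by
      ext
      simp only [List.get_eq_getElem]
      exact (varList_nodup φ).idxOf_getElem _ _
    rwa [hi] at this
  have he_surj : Function.Surjective e := by
    intro σ
    refine ⟨fun i => σ ⟨vl.get i, mem_varList_iff_mem_vars.1 (List.get_mem vl i)⟩, ?_⟩
    funext v
    simp only [e]
    congr 1
    ext
    simp only [List.get_eq_getElem]
    exact List.getElem_idxOf (hidx v.1 v.2)
  have heval : ∀ b : Fin vl.length → Bool, φ.eval (assignOf vl b) = φ.eval (φ.extendAssignment (e b)) := by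
    intro b
    refine cnf_eval_congr fun v hv => ?_
    unfold assignOf CNF.extendAssignment
    rw [dif_pos (hidx v hv), dif_pos hv]
  unfold CNF.numSat
  refine Finset.card_bij (fun b _ => e b) (fun b hb => ?_) (fun b _ b' _ h => he_inj h) (fun σ hσ => ?_)
  · rw [mem_filter] at hb ⊢
    exact ⟨mem_univ _, by rw [← heval]; exact hb.2⟩
  · obtain ⟨b, rfl⟩ := he_surj σ
    rw [mem_filter] at hσ
    exact ⟨b, by rw [mem_filter]; exact ⟨mem_univ _, by rw [heval]; exact hσ.2⟩, rfl⟩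

/-! ### Replaying the oracle machine with claimed answers (LFKN Lemma 3) -/

/-- **The claimed oracle answers** read off the prover's first message `t[1]`: the list decoded from its
first component (total decoding: `decNil ∘ fstF`; the honest prover sends `⟨encList answers, padding⟩`).
[cite: LundEtAl1992, Lemma 3 (proof sketch: "reduce the membership problem for `L'` to that of verifying" the oracle values)] -/
def ansOf (t : List (List Bool)) : List (List Bool) := decNil (fstF (t.getD 1 []))

/-- Step `i` of the replay: after the first `i` claimed answers `M` asks a query of length `≤ qn`.
[cite: AroraBarak2009, §3.4 (the next query is determined by the input and the previous answers)] -/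
def stepOK (M : OracleAlg Bool) (x : List Bool) (ans : List (List Bool)) (qn i : ℕ) : Bool :=
  match M.step x (ans.take i) with
  | Sum.inl y => decide (y.length ≤ qn)
  | Sum.inr _ => false

/-- **The replay test**: at most `qn` claimed answers, every step along them is a query of length
`≤ qn`, and the step after all of them ACCEPTS. [cite: LundEtAl1992, Lemma 3] -/
def replayOK (M : OracleAlg Bool) (x : List Bool) (ans : List (List Bool)) (qn : ℕ) : Bool :=
  decide (ans.length ≤ qn) && ((List.range ans.length).all (stepOK M x ans qn) &&
    decide (M.step x ans = Sum.inr true))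

/-- Reading `stepOK`. [folklore] -/
theorem stepOK_eq_true_iff (M : OracleAlg Bool) (x : List Bool) (ans : List (List Bool)) (qn i : ℕ) :
    stepOK M x ans qn i = true ↔ ∃ y, M.step x (ans.take i) = Sum.inl y ∧ y.length ≤ qn := by
  unfold stepOK
  cases M.step x (ans.take i) with
  | inl y => simp
  | inr b => simp

/-- Reading `replayOK`. [folklore] -/
theorem replayOK_eq_true_iff (M : OracleAlg Bool) (x : List Bool) (ans : List (List Bool)) (qn : ℕ) :
    replayOK M x ans qn = true ↔ ans.length ≤ qn ∧
      (∀ i < ans.length, ∃ y, M.step x (ans.take i) = Sum.inl y ∧ y.length ≤ qn) ∧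
        M.step x ans = Sum.inr true := by
  unfold replayOK
  rw [Bool.and_eq_true, Bool.and_eq_true, decide_eq_true_eq, decide_eq_true_eq, List.all_eq_true]
  simp only [List.mem_range, stepOK_eq_true_iff]

/-- `l ↾ (i+1) = l ↾ i ++ [lᵢ]` inside the list. [folklore] -/
theorem take_succ_eq_getD {α : Type} (l : List α) (d : α) {i : ℕ} (hi : i < l.length) :
    l.take (i + 1) = l.take i ++ [l.getD i d] := by
  rw [List.take_add_one, List.getD_eq_getElem _ _ hi, List.getElem?_eq_getElem hi]
  rfl

/-- **Claimed answers that are the oracle's drive the run**: if every step along the claimed answers is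
a query answered by `O` with the claimed answer, the free-running transcript of `M` with `O` is the
list of claimed answers. [cite: AroraBarak2009, §3.4] -/
theorem trans_eq_take_of_answers {β : Type} (M : OracleAlg β) (O : Oracle) (x : List Bool) (ans : List (List Bool))
    (hans : ∀ i < ans.length, ∃ y, M.step x (ans.take i) = Sum.inl y ∧ O y = ans.getD i []) :
    ∀ i ≤ ans.length, PRelSigma.trans M O x i = ans.take i
  | 0, _ => by simp
  | i + 1, hi => by
    have ih := trans_eq_take_of_answers M O x ans hans i (Nat.le_of_succ_le hi)
    obtain ⟨y, hy, hO⟩ := hans i hi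
    rw [PRelSigma.trans_succ, ih, PRelSigma.qryOf_eq_of_step_eq hy, hO, take_succ_eq_getD ans [] hi]

/-- **If all claimed answers are true, the replayed accepting run is the true run**: `M` with oracle
`O` accepts `x` within `|ans| + 1` rounds. [cite: LundEtAl1992, Lemma 3] -/
theorem run_eq_some_true_of_answers {M : OracleAlg Bool} {O : Oracle} {x : List Bool} {ans : List (List Bool)}
    (hans : ∀ i < ans.length, ∃ y, M.step x (ans.take i) = Sum.inl y ∧ O y = ans.getD i [])
    (hfin : M.step x ans = Sum.inr true) : M.run O (ans.length + 1) x = some true := by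
  rw [PRelSigma.run_eq_some_iff]
  refine ⟨ans.length, Nat.lt_succ_self _, fun i hi => ?_, ?_⟩
  · obtain ⟨y, hy, -⟩ := hans i hi
    exact ⟨y, by rw [trans_eq_take_of_answers M O x ans hans i hi.le]; exact hy⟩
  · rw [trans_eq_take_of_answers M O x ans hans _ le_rfl, List.take_length]
    exact hfin

/-- Hence the output of any halting run of `M` with `O` on `x` is `1`. [cite: LundEtAl1992, Lemma 3] -/
theorem eq_true_of_run_of_answers {M : OracleAlg Bool} {O : Oracle} {x : List Bool} {ans : List (List Bool)}
    {n : ℕ} {b : Bool} (hrun : M.run O n x = some b)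
    (hans : ∀ i < ans.length, ∃ y, M.step x (ans.take i) = Sum.inl y ∧ O y = ans.getD i [])
    (hfin : M.step x ans = Sum.inr true) : b = true := by
  have h1 := run_eq_some_true_of_answers hans hfin
  rcases le_total n (ans.length + 1) with hle | hle
  · have h2 := M.run_mono O x hle hrun
    rw [h1] at h2
    simpa using h2.symm
  · have h2 := M.run_mono O x hle h1
    rw [hrun] at h2
    simpa using h2

/-! ### The referee -/

/-- The `i`-th claim `Kᵢ`: the claimed answer read as a binary numeral. [cite: LundEtAl1992, Lemma 3] -/
def claimK (ans : List (List Bool)) (i : ℕ) : ℤ := (bitsToNat (ans.getD i []) : ℤ)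

/-- The `i`-th claimed answer is a CANONICAL binary numeral (the oracle `Oracle.ofFun f` answers with
`encodeNat (f y)`, so a non-canonical string is never a true answer). [folklore] -/
def canonAns (ans : List (List Bool)) (i : ℕ) : Bool := decide (encodeNat (bitsToNat (ans.getD i [])) = ans.getD i [])

/-- **The `i`-th instance**: the CNF of the `i`-th replayed query under the parsimonious reduction
`red` (so that the claim "`f(yᵢ) = Kᵢ`" reads "`#SAT(φᵢ) = Kᵢ`"). [cite: LundEtAl1992, Lemma 3]
[cite: AroraBarakCC2009, §17.3.1 (the Cook–Levin reduction is parsimonious)] -/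
def instOf (M : OracleAlg Bool) (red : List Bool → CNF ℕ) (x : List Bool) (ans : List (List Bool)) (i : ℕ) : CNF ℕ :=
  red (PRelSigma.qryOf M x (ans.take i))

/-- **The referee's core test** with parameters `ℓ` (challenge bits), `D` (coefficients per message),
`W` (width of a coefficient), `R` (round slots per instance), `qn` (query/round budget of `M`): the
replay test, and for every claimed answer its canonicity and the sumcheck test of its instance in the
slots `iR, iR + 1, …`. [cite: LundEtAl1992, Lemma 3 and §3] [cite: AroraBarakCC2009, Thm. 8.21] -/
def refCore (M : OracleAlg Bool) (red : List Bool → CNF ℕ) (ℓ D W R qn : ℕ) (x : List Bool)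
    (t : List (List Bool)) : Bool :=
  replayOK M x (ansOf t) qn &&
    (List.range (ansOf t).length).all fun i =>
      canonAns (ansOf t) i && instCheck ℓ D W t (i * R) (instOf M red x (ansOf t) i) (claimK (ansOf t) i)

/-- Reading `refCore`. [folklore] -/
theorem refCore_eq_true_iff (M : OracleAlg Bool) (red : List Bool → CNF ℕ) (ℓ D W R qn : ℕ) (x : List Bool)
    (t : List (List Bool)) :
    refCore M red ℓ D W R qn x t = true ↔ replayOK M x (ansOf t) qn = true ∧
      ∀ i < (ansOf t).length, canonAns (ansOf t) i = true ∧
        instCheck ℓ D W t (i * R) (instOf M red x (ansOf t) i) (claimK (ansOf t) i) = true := by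
  unfold refCore
  rw [Bool.and_eq_true, List.all_eq_true]
  simp only [List.mem_range, Bool.and_eq_true]

/-- **Deterministic soundness of the referee.** If `M` with the oracle of `f` decides `x ∉ L`
(`hrun`), `red` is parsimonious for `f`, and the referee accepts the transcript `t`, then some instance
`i` has a round `j` in which the prover's polynomial is not the honest `h` and the challenge is a root
of their difference (Lemma 3: some claimed answer is false; then `Sumcheck.soundness` for that
instance, the claim `Kᵢ ≠ #SAT(φᵢ) = H_{φᵢ}(ε)`). [cite: LundEtAl1992, Lemma 3 and §3 (proof of Thm. 1, (2))]
[cite: AroraBarakCC2009, Thm. 8.21 (proof of the Claim)] -/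
theorem exists_badRound_of_refCore {M : OracleAlg Bool} {red : List Bool → CNF ℕ} {f : List Bool → ℕ}
    (hred : ∀ y, (red y).numSat = f y) {L : Language Bool} {x : List Bool} {n : ℕ}
    (hrun : M.run (Oracle.ofFun f) n x = some (L.boolIndicator x)) (hx : x ∉ L)
    {ℓ D W R qn : ℕ} {t : List (List Bool)} (hacc : refCore M red ℓ D W R qn x t = true) :
    ∃ i < (ansOf t).length, ∃ j < (varList (instOf M red x (ansOf t) i)).length,
      stratIP D W t (i * R) j ≠ h (instOf M red x (ansOf t) i) (varList (instOf M red x (ansOf t) i))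
          (chals ℓ t (i * R) j) ∧
        (stratIP D W t (i * R) j - h (instOf M red x (ansOf t) i) (varList (instOf M red x (ansOf t) i))
          (chals ℓ t (i * R) j)).IsRoot (chalVal ℓ t (i * R + j)) := by
  set ans := ansOf t with hans
  obtain ⟨hrep, hinst⟩ := (refCore_eq_true_iff M red ℓ D W R qn x t).1 hacc
  obtain ⟨-, hsteps, hfin⟩ := (replayOK_eq_true_iff M x ans qn).1 hrep
  -- some claimed answer is not the oracle's
  have hnot : ¬ ∀ i < ans.length, ans.getD i [] = encodeNat (f (PRelSigma.qryOf M x (ans.take i))) := by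
    intro hall
    have hb := eq_true_of_run_of_answers hrun (fun i hi => ?_) hfin
    · exact hx ((Set.mem_iff_boolIndicator _ _).2 hb)
    · obtain ⟨y, hy, -⟩ := hsteps i hi
      refine ⟨y, hy, ?_⟩
      rw [hall i hi, Oracle.ofFun_apply, PRelSigma.qryOf_eq_of_step_eq hy]
  push Not at hnot
  obtain ⟨i, hi, hne⟩ := hnot
  obtain ⟨hcan, hchk⟩ := hinst i hi
  refine ⟨i, hi, ?_⟩
  set φ := instOf M red x ans i with hφ
  -- the claim is false
  have hK : claimK ans i ≠ H φ (varList φ) [] := by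
    rw [H_varList_nil_eq_numSat, hφ, instOf, hred]
    unfold claimK
    intro hK
    have hK' : bitsToNat (ans.getD i []) = f (PRelSigma.qryOf M x (ans.take i)) := by exact_mod_cast hK
    unfold canonAns at hcan
    rw [decide_eq_true_eq] at hcan
    exact hne (by rw [← hcan, hK'])
  have hA := (instCheck_eq_true_iff ℓ D W t (i * R) φ (claimK ans i)).1 hchk
  obtain ⟨j, hj, hs, hroot⟩ := Sumcheck.soundness φ (varList φ) (length_chals _ _ _ _) hK hA
  refine ⟨j, hj, ?_, ?_⟩
  · rwa [take_chals hj.le] at hs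
  · rwa [take_chals hj.le, getD_chals hj] at hroot

/-! ### Deterministic completeness: the honest transcript is accepted -/

/-- `decodeCoeffs` reads only the first `D · W` bits. [folklore] -/
theorem decodeCoeffs_take (W D : ℕ) (s : List Bool) : decodeCoeffs W D (s.take (D * W)) = decodeCoeffs W D s := by
  unfold decodeCoeffs
  rw [chunks_take s le_rfl]

/-- **Width arithmetic**: if `N` bounds the code length of `φ`, the challenges have absolute value
`≤ 2^ℓ` (`ℓ ≥ 1`) and `N + (ℓ+3)N + N + 2 ≤ W`, then every coefficient of the honest polynomial `h`
fits in `W - 1` magnitude bits (`Sumcheck.abs_coeff_h_le`). [cite: AroraBarakCC2009, §8.3.2 (polynomial-size messages)] -/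
theorem natAbs_coeff_h_lt_of_le (φ : CNF ℕ) {N ℓ W : ℕ} (hN : (encodingCNF.encode φ).length ≤ N) (hℓ : 1 ≤ ℓ)
    (hW : N + (ℓ + 3) * N + N + 2 ≤ W) {pref : List ℤ} (hpref : ∀ x ∈ pref, |x| ≤ 2 ^ ℓ) (j : ℕ) :
    ((h φ (varList φ) pref).coeff j).natAbs < 2 ^ (W - 1) := by
  have hb := abs_coeff_h_le φ (varList φ) hℓ hpref j
  have hsz := size_le_length_encode φ
  have hvl := length_varList_le_length_encode φ
  have hexp : (varList φ).length + (ℓ + 3) * φ.size + φ.length < W - 1 := by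
    have h1 : (ℓ + 3) * φ.size ≤ (ℓ + 3) * N := Nat.mul_le_mul_left _ (hsz.1.trans hN)
    omega
  have hlt : |(h φ (varList φ) pref).coeff j| < 2 ^ (W - 1) := hb.trans_lt (pow_lt_pow_right₀ (by norm_num) hexp)
  have hcast : (((h φ (varList φ) pref).coeff j).natAbs : ℤ) < 2 ^ (W - 1) := by
    rw [Int.natCast_natAbs]; exact hlt
  exact_mod_cast hcast

/-- **Honest messages decode to the honest polynomials**: if the first `D·W` bits of the round-`(u₀+j)`
message are the fixed-width code of `h` at the earlier challenges of the instance, then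
`stratIP … j = h …` (coefficients fit by `natAbs_coeff_h_lt_of_le`, degree `≤ size φ ≤ N < D`).
[cite: AroraBarakCC2009, Thm. 8.21 (proof: "if the prover is not cheating, `s = h`")] -/
theorem stratIP_eq_h_of_honest (φ : CNF ℕ) {N ℓ D W : ℕ} (hN : (encodingCNF.encode φ).length ≤ N) (hℓ : 1 ≤ ℓ)
    (hW : N + (ℓ + 3) * N + N + 2 ≤ W) (hD : N + 1 ≤ D) {t : List (List Bool)} {u₀ j : ℕ}
    (hmsg : (polyMsg t (u₀ + j)).take (D * W) = encodeCoeffs W D (h φ (varList φ) (chals ℓ t u₀ j))) :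
    stratIP D W t u₀ j = h φ (varList φ) (chals ℓ t u₀ j) := by
  unfold stratIP
  rw [← decodeCoeffs_take, hmsg, decodeCoeffs_encodeCoeffs (by omega)
    (fun k => natAbs_coeff_h_lt_of_le φ hN hℓ hW (fun x hx => abs_le_of_mem_chals hx) k), ofCoeffs_map_coeff]
  refine (natDegree_h_le _ _ _).trans_lt ?_
  have := (size_le_length_encode φ).1
  omega

/-- **Deterministic completeness of the referee.** Suppose `M` with the oracle of `f` ACCEPTS `x` at
round `m ≤ qn` after `m` queries of length `≤ qn` (the `P^{#P}` run of an input in `L`), the prover's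
first message carries the true answers (`ansOf t = trans M O x m`), every instance code has length
`≤ N`, the parameters satisfy the width arithmetic, and in every used round the prover's message starts
with the code of the honest polynomial `h`. Then the referee accepts. [cite: LundEtAl1992, §3 (proof of Thm. 1, (1): "a prover who truthfully answers … induces Vanna to accept with probability 1")]
[cite: AroraBarakCC2009, Thm. 8.21 (proof: completeness)] -/
theorem refCore_of_honest {M : OracleAlg Bool} {red : List Bool → CNF ℕ} {f : List Bool → ℕ}
    (hred : ∀ y, (red y).numSat = f y) {x : List Bool} {m qn : ℕ} (hm : m ≤ qn)
    (hsteps : ∀ i < m, ∃ y, M.step x (PRelSigma.trans M (Oracle.ofFun f) x i) = Sum.inl y ∧ y.length ≤ qn)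
    (hfin : M.step x (PRelSigma.trans M (Oracle.ofFun f) x m) = Sum.inr true)
    {ℓ D W R N : ℕ} (hℓ : 1 ≤ ℓ) (hW : N + (ℓ + 3) * N + N + 2 ≤ W) (hD : N + 1 ≤ D)
    {t : List (List Bool)} (hans : ansOf t = PRelSigma.trans M (Oracle.ofFun f) x m)
    (hN : ∀ i < m, (encodingCNF.encode (instOf M red x (ansOf t) i)).length ≤ N)
    (hmsg : ∀ i < m, ∀ j < (varList (instOf M red x (ansOf t) i)).length,
      (polyMsg t (i * R + j)).take (D * W) =
        encodeCoeffs W D (h (instOf M red x (ansOf t) i) (varList (instOf M red x (ansOf t) i)) (chals ℓ t (i * R) j))) :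
    refCore M red ℓ D W R qn x t = true := by
  set O := Oracle.ofFun f with hO
  set ans := ansOf t with hans'
  have hlen : ans.length = m := by rw [hans, OracleCompose.length_trans]
  have htake : ∀ i ≤ m, ans.take i = PRelSigma.trans M O x i := fun i hi => by
    rw [hans]; exact OracleCompose.trans_take M O x hi
  have hget : ∀ i < m, ans.getD i [] = O (PRelSigma.qryOf M x (PRelSigma.trans M O x i)) := fun i hi => by
    rw [List.getD_eq_getElem?_getD, hans, OracleCompose.getElem?_trans M O x hi, Option.getD_some]
  rw [refCore_eq_true_iff]
  refine ⟨(replayOK_eq_true_iff M x ans qn).2 ⟨hlen ▸ hm, fun i hi => ?_, ?_⟩, fun i hi => ⟨?_, ?_⟩⟩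
  · rw [hlen] at hi
    rw [htake i hi.le]
    exact hsteps i hi
  · rw [← List.take_length (l := ans), hlen, htake m le_rfl]
    exact hfin
  · rw [hlen] at hi
    unfold canonAns
    rw [hget i hi, hO, Oracle.ofFun_apply, bitsToNat_encodeNat, decide_eq_true rfl]
  · rw [hlen] at hi
    set φ := instOf M red x ans i with hφ
    set vl := varList φ with hvl
    rw [instCheck_eq_true_iff]
    have hK : claimK ans i = H φ vl [] := by
      rw [H_varList_nil_eq_numSat, hφ, instOf, hred, htake i hi.le]
      unfold claimK
      rw [hget i hi, hO, Oracle.ofFun_apply, bitsToNat_encodeNat]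
    rw [hK]
    have hcomp := Sumcheck.completeness φ vl (chals ℓ t (i * R) vl.length) (by simp)
    refine accepts_of_strat_eq (fun j hj => ?_) hcomp
    rw [take_chals hj.le]
    exact stratIP_eq_h_of_honest φ (hN i hi) hℓ hW hD (hmsg i hi j hj)
/-! ### The step function of an oracle algorithm on codes -/

/-- Code of a step result (`0 y` for the query `y`, `1 b` for the output `b`; `PRelSigma.stepCode`). [folklore] -/
abbrev stepE : (List Bool ⊕ Bool) → List Bool := PRelSigma.stepCode

/-- Is the step a query? [folklore] -/
def isQuery : List Bool ⊕ Bool → Bool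
  | Sum.inl _ => true
  | Sum.inr _ => false

/-- The query of a step (junk `ε` for an output; `PRelSigma.qryOf` on results). [folklore] -/
def queryOf : List Bool ⊕ Bool → List Bool
  | Sum.inl y => y
  | Sum.inr _ => []

/-- `qryOf` is `queryOf` of the step. [folklore] -/
theorem qryOf_eq_queryOf (M : OracleAlg Bool) (x : List Bool) (as : List (List Bool)) :
    PRelSigma.qryOf M x as = queryOf (M.step x as) := by
  unfold PRelSigma.qryOf queryOf
  cases M.step x as <;> rfl

/-- The total re-encoding of the answer component: `w ↦ listBool (decNil (sndF w))`. [folklore] -/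
theorem exists_recodeAnswers : ∃ H ∈ FP, ∀ w : List Bool,
    H w = (encodingList Bool).listBool.encode (decNil (sndF w)) := by
  obtain ⟨H, hH, hHs⟩ : CodeFP strE (listE strE) (fun w => decNil (sndF w)) :=
    (listOfRaw strE).comp ((decNilC.comp (of_fn sndF sndF_mem_FP fun _ => rfl : CodeFP strE strE sndF)).congr fun _ => rfl)
  refine ⟨H, hH, fun w => (hHs w).trans ?_⟩
  rw [show ((encodingList Bool).listBool.encode : List (List Bool) → List Bool) = listE strE from
    listE_eq (encodingList Bool)]

variable (M : OracleAlg Bool)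

/-- **The step function on codes**: for a polynomial-time oracle algorithm, `(x, answers) ↦
M.step x answers` is computed on the pair/list codes in polynomial time (the step machine composed
with the total parse-and-re-encode of its input, `PolyTimeComputable.comp`). [cite: AroraBarak2009, §3.4 with Thm. 2.8 (composition)] -/
theorem stepC (hM : M.IsPolyTime encodingBoolBool) :
    CodeFP (pairE strE (listE strE)) stepE (fun p => M.step p.1 p.2) := by
  obtain ⟨H, hH, hHs⟩ := exists_recodeAnswers
  have hin : fanoutFn fstF (H ∘ sndF) ∈ FP := fanoutFn_mem_FP fstF_mem_FP (comp_mem_FP hH sndF_mem_FP)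
  have hG : PolyTimeComputable (_root_.id : List Bool → List Bool)
      (fun p : List Bool × List (List Bool) => boolPair p.1 ((encodingList Bool).listBool.encode p.2))
      (fun v => (fstF v, decNil (sndF (sndF v)))) := by
    obtain ⟨p, Mx, h⟩ := hin
    refine ⟨p, Mx, fun v => ?_⟩
    have hv := h v
    simp only [_root_.id, fanoutFn_apply, Function.comp_apply, hHs] at hv ⊢
    exact hv
  obtain ⟨p, Mx, h⟩ := PolyTimeComputable.comp_holds hM hG
  refine ⟨fun v => PRelSigma.stepCode (M.step (fstF v) (decNil (sndF (sndF v)))), ⟨p, Mx, fun v => h v⟩, fun q => ?_⟩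
  obtain ⟨x, as⟩ := q
  simp only [pairE_apply, fstF_boolPair, sndF_boolPair, listE, decNil_rawE, List.map_id]
  rfl

/-- The query test on codes (the head bit is `0`). [folklore] -/
theorem isQueryC : CodeFP stepE bitE isQuery := by
  have h : CodeFP stepE bitE (fun r => !((stepE r).getD 0 false)) :=
    (strGetDNat.comp ((transparent fun _ => rfl : CodeFP stepE strE stepE).pair (const _ 0))).not
  exact h.congr fun r => by cases r <;> rfl

/-- The query of a step on codes (the tail of a query code). [folklore] -/
theorem queryOfC : CodeFP stepE strE queryOf := by
  have htail : CodeFP stepE strE (fun r => (stepE r).tail) :=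
    of_fn List.tail PRelSigma.tail_mem_FP fun _ => rfl
  exact (isQueryC.ite htail (const _ ([] : List Bool))).congr fun r => by cases r <;> rfl

/-- The acceptance test on codes (the code is `11`). [folklore] -/
theorem isAcceptC : CodeFP stepE bitE (fun r => decide (r = Sum.inr true)) := by
  have h : CodeFP stepE bitE (fun r => decide (stepE r = [true, true])) :=
    (CodeFP.eq (eα := strE) fun a b h => h).comp ((transparent fun _ => rfl : CodeFP stepE strE stepE).pair
      (const _ [true, true]))
  refine h.congr fun r => ?_
  rcases r with y | b
  · simp [stepE]
  · cases b <;> simp [stepE]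

/-! ### Transcript accessors on codes -/

/-- `(t, u) ↦ t[2u + 3]`. [folklore] -/
theorem polyMsgC : CodeFP (pairE (rawE strE) natE) strE (fun p => polyMsg p.1 p.2) := by
  have hidx : CodeFP (pairE (rawE strE) natE) natE (fun p => 2 * p.2 + 3) :=
    (natAdd.comp ((natMul.comp ((const _ 2).pair (snd _ _))).pair (const _ 3)) :)
  exact ((rawGetD strE (d := ([] : List Bool)) rfl).comp ((fst _ _).pair hidx)).congr fun p => rfl

/-- `(t, u) ↦ t[2u + 4]`. [folklore] -/
theorem chalBlkC : CodeFP (pairE (rawE strE) natE) strE (fun p => chalBlk p.1 p.2) := by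
  have hidx : CodeFP (pairE (rawE strE) natE) natE (fun p => 2 * p.2 + 4) :=
    (natAdd.comp ((natMul.comp ((const _ 2).pair (snd _ _))).pair (const _ 4)) :)
  exact ((rawGetD strE (d := ([] : List Bool)) rfl).comp ((fst _ _).pair hidx)).congr fun p => rfl

/-- `(1^ℓ, t, u) ↦ chalVal ℓ t u`. [folklore] -/
theorem chalValC : CodeFP (pairE unE (pairE (rawE strE) natE)) intE (fun p => chalVal p.1 p.2.1 p.2.2) := by
  have hblk : CodeFP (pairE unE (pairE (rawE strE) natE)) strE (fun p => (chalBlk p.2.1 p.2.2).take p.1) :=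
    (strTake.comp ((fst _ _).pair (chalBlkC.comp (snd _ _))) :)
  exact (intOfNat.comp (strVal.comp hblk)).congr fun p => rfl

/-- `(1^ℓ, t, u₀, 1ᵏ) ↦ chals ℓ t u₀ k`. [folklore] -/
theorem chalsC : CodeFP (pairE unE (pairE (rawE strE) (pairE natE unE))) (rawE intE)
    (fun p => chals p.1 p.2.1 p.2.2.1 p.2.2.2) := by
  have hitem : CodeFP (pairE (pairE unE (pairE (rawE strE) (pairE natE unE))) natE) intE
      (fun q => chalVal q.1.1 q.1.2.1 (q.1.2.2.1 + q.2)) :=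
    (chalValC.comp ((fst _ _).fst'.pair ((fst _ _).snd'.fst'.pair (natAdd.comp ((fst _ _).snd'.snd'.fst'.pair (snd _ _))))) :)
  have hmap := map (σ := ℕ × List (List Bool) × ℕ × ℕ) (eσ := pairE unE (pairE (rawE strE) (pairE natE unE)))
    (g := fun q => chalVal q.1.1 q.1.2.1 (q.1.2.2.1 + q.2)) hitem
  exact (hmap.comp ((CodeFP.id _).pair (urange.comp (snd _ _).snd'.snd'))).congr fun p => rfl

/-- `t ↦ ansOf t`. [folklore] -/
theorem ansOfC : CodeFP (rawE strE) (rawE strE) ansOf := by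
  have h1 : CodeFP (rawE strE) strE (fun t => t.getD 1 []) :=
    (rawGetD strE (d := ([] : List Bool)) rfl).comp ((CodeFP.id _).pair (const _ 1))
  have hf : CodeFP strE strE fstF := of_fn fstF fstF_mem_FP fun _ => rfl
  exact (decNilC.comp (hf.comp h1)).congr fun t => rfl

/-! ### One sumcheck instance on codes -/

/-- Context of the round fold: `1^ℓ`, `1ᴰ`, `1ᵂ`, the transcript, the first round `u₀`, the claim `K`. [folklore] -/
abbrev RoundCtxIP : Type := ℕ × ℕ × ℕ × List (List Bool) × ℕ × ℤ

/-- Code of the round context. [folklore] -/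
abbrev ctxIPE : RoundCtxIP → List Bool := pairE unE (pairE unE (pairE unE (pairE (rawE strE) (pairE natE intE))))

/-- Code of the verifier's state `(claim, all checks passed)`. [folklore] -/
abbrev stIPE : ℤ × Bool → List Bool := pairE intE bitE

/-- **One round** (`roundStepIP`) on codes: context, round index, state ↦ new state.
[cite: AroraBarakCC2009, §8.3.2 (Sumcheck protocol, one step of `V`)] -/
theorem roundStepIPC : CodeFP (pairE ctxIPE (pairE natE stIPE)) stIPE
    (fun q => roundStepIP q.1.1 q.1.2.1 q.1.2.2.1 q.1.2.2.2.1 q.1.2.2.2.2.1 q.2.2 q.2.1) := by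
  have hℓ : CodeFP (pairE ctxIPE (pairE natE stIPE)) unE (fun q => q.1.1) := (fst _ _).fst'
  have hD : CodeFP (pairE ctxIPE (pairE natE stIPE)) unE (fun q => q.1.2.1) := (fst _ _).snd'.fst'
  have hW : CodeFP (pairE ctxIPE (pairE natE stIPE)) unE (fun q => q.1.2.2.1) := (fst _ _).snd'.snd'.fst'
  have ht : CodeFP (pairE ctxIPE (pairE natE stIPE)) (rawE strE) (fun q => q.1.2.2.2.1) := (fst _ _).snd'.snd'.snd'.fst'
  have hu₀ : CodeFP (pairE ctxIPE (pairE natE stIPE)) natE (fun q => q.1.2.2.2.2.1) := (fst _ _).snd'.snd'.snd'.snd'.fst'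
  have hj : CodeFP (pairE ctxIPE (pairE natE stIPE)) natE (fun q => q.2.1) := (snd _ _).fst'
  have hv : CodeFP (pairE ctxIPE (pairE natE stIPE)) intE (fun q => q.2.2.1) := (snd _ _).snd'.fst'
  have hok : CodeFP (pairE ctxIPE (pairE natE stIPE)) bitE (fun q => q.2.2.2) := (snd _ _).snd'.snd'
  have hu : CodeFP (pairE ctxIPE (pairE natE stIPE)) natE (fun q => q.1.2.2.2.2.1 + q.2.1) := (natAdd.comp (hu₀.pair hj) :)
  have hmsg : CodeFP (pairE ctxIPE (pairE natE stIPE)) strE (fun q => polyMsg q.1.2.2.2.1 (q.1.2.2.2.2.1 + q.2.1)) :=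
    (polyMsgC.comp (ht.pair hu) :)
  have hcs : CodeFP (pairE ctxIPE (pairE natE stIPE)) (rawE intE)
      (fun q => decodeCoeffs q.1.2.2.1 q.1.2.1 (polyMsg q.1.2.2.2.1 (q.1.2.2.2.2.1 + q.2.1))) :=
    (decodeCoeffsC.comp (hD.pair (hW.pair hmsg)) :)
  have hr : CodeFP (pairE ctxIPE (pairE natE stIPE)) intE (fun q => chalVal q.1.1 q.1.2.2.2.1 (q.1.2.2.2.2.1 + q.2.1)) :=
    (chalValC.comp (hℓ.pair (ht.pair hu)) :)
  have heval : ∀ {g : RoundCtxIP × ℕ × ℤ × Bool → ℤ}, CodeFP (pairE ctxIPE (pairE natE stIPE)) intE g →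
      CodeFP (pairE ctxIPE (pairE natE stIPE)) intE (fun q => evalAtCap (g q) q.1.2.1
        (decodeCoeffs q.1.2.2.1 q.1.2.1 (polyMsg q.1.2.2.2.1 (q.1.2.2.2.2.1 + q.2.1)))) :=
    fun hg => (evalAtC.comp (hg.pair (hD.pair hcs)) :)
  have he_r := heval hr
  have he0 := heval (const _ (0 : ℤ))
  have he1 := heval (const _ (1 : ℤ))
  have hcheck : CodeFP (pairE ctxIPE (pairE natE stIPE)) bitE (fun q =>
      decide (evalAtCap 0 q.1.2.1 (decodeCoeffs q.1.2.2.1 q.1.2.1 (polyMsg q.1.2.2.2.1 (q.1.2.2.2.2.1 + q.2.1))) +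
        evalAtCap 1 q.1.2.1 (decodeCoeffs q.1.2.2.1 q.1.2.1 (polyMsg q.1.2.2.2.1 (q.1.2.2.2.2.1 + q.2.1))) = q.2.2.1)) :=
    (intEq.comp ((intAdd.comp (he0.pair he1)).pair hv) :)
  refine ((he_r.pair (hok.and hcheck)).congr fun q => ?_)
  have hlen : (decodeCoeffs q.1.2.2.1 q.1.2.1 (polyMsg q.1.2.2.2.1 (q.1.2.2.2.2.1 + q.2.1))).length ≤ q.1.2.1 := by
    rw [length_decodeCoeffs]
  unfold roundStepIP
  simp only [evalAtCap_eq hlen, evalCoeffs_eq]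

/-- Along the round fold the claim is the initial one or a round value, whose size is bounded as in
`size_natAbs_roundValue_le` (challenge blocks of length `≤ ℓ`). [folklore] -/
theorem foldl_roundStepIP_fst (ℓ D W : ℕ) (t : List (List Bool)) (u₀ : ℕ) : ∀ (l : List ℕ) (st : ℤ × Bool) (K : ℤ),
    (st.1 = K ∨ Nat.size st.1.natAbs ≤ D + W + ℓ * D) →
      (l.foldl (roundStepIP ℓ D W t u₀) st).1 = K ∨ Nat.size (l.foldl (roundStepIP ℓ D W t u₀) st).1.natAbs ≤ D + W + ℓ * D
  | [], _, _, h => h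
  | j :: l, st, K, _ => by
    rw [List.foldl_cons]
    refine foldl_roundStepIP_fst ℓ D W t u₀ l _ K (Or.inr ?_)
    unfold roundStepIP chalVal
    simp only [evalCoeffs_eq]
    exact size_natAbs_roundValue_le (by rw [List.length_take]; exact min_le_left _ _)

/-- **The code of the state stays quadratic** along the round fold, in the length of the fold's input.
[cite: AroraBarakCC2009, §1.3 (polynomially bounded loops)] -/
theorem runStateIP_length_le (s : RoundCtxIP) (l₁ l₂ : List ℕ) :
    (stIPE (l₁.foldl (roundStepIP s.1 s.2.1 s.2.2.1 s.2.2.2.1 s.2.2.2.2.1) (s.2.2.2.2.2, true))).length ≤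
      ((3 * X + 3) ^ 2 : Polynomial ℕ).eval (pairE ctxIPE (rawE natE) (s, l₁ ++ l₂)).length := by
  obtain ⟨ℓ, D, W, t, u₀, K⟩ := s
  set L := (pairE ctxIPE (rawE natE) ((ℓ, D, W, t, u₀, K), l₁ ++ l₂)).length with hL
  have hLexp : L = 2 * (2 * (unE ℓ).length + 2 + (2 * (unE D).length + 2 + (2 * (unE W).length + 2 +
      (2 * (rawE strE t).length + 2 + (2 * (natE u₀).length + 2 + (intE K).length))))) + 2 + (rawE natE (l₁ ++ l₂)).length := by
    simp [hL, pairE]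
  rw [length_unE, length_unE, length_unE] at hLexp
  have hℓL : ℓ ≤ L := by omega
  have hDL : D ≤ L := by omega
  have hWL : W ≤ L := by omega
  have hKL : (intE K).length ≤ L := by omega
  set st := l₁.foldl (roundStepIP ℓ D W t u₀) (K, true) with hst
  have hcode : (stIPE st).length = 2 * (intE st.1).length + 2 + 1 := by
    simp [bitE]
  have hv : (intE st.1).length ≤ L + 3 * (L + L + L * L) + 2 := by
    rcases foldl_roundStepIP_fst ℓ D W t u₀ l₁ (K, true) K (Or.inl rfl) with h | h
    · rw [← hst] at h; rw [h]; omega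
    · rw [← hst] at h
      have h3 := length_dpEnc_le st.1
      have : Nat.size st.1.natAbs ≤ L + L + L * L :=
        h.trans (Nat.add_le_add (Nat.add_le_add hDL hWL) (Nat.mul_le_mul hℓL hDL))
      change (dpEnc st.1).length ≤ _
      omega
  simp only [eval_pow, eval_add, eval_mul, eval_X, eval_ofNat]
  change (stIPE st).length ≤ (3 * L + 3) ^ 2
  rw [hcode]
  nlinarith

/-- **`k` rounds** (`runRoundsIP`) on codes: `(context, 1ᵏ) ↦` final state, by `CodeFP.foldl` over
`[0, …, k)`. [cite: AroraBarakCC2009, §8.3.2 (Sumcheck protocol)] -/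
theorem runRoundsIPC : CodeFP (pairE ctxIPE unE) stIPE
    (fun p => runRoundsIP p.1.1 p.1.2.1 p.1.2.2.1 p.1.2.2.2.1 p.1.2.2.2.2.1 p.1.2.2.2.2.2 p.2) := by
  have hinit : CodeFP ctxIPE stIPE (fun s => (s.2.2.2.2.2, true)) := (snd _ _).snd'.snd'.snd'.snd'.pair (const _ true)
  have h := foldl (σ := RoundCtxIP) (α := ℕ) (β := ℤ × Bool) (eσ := ctxIPE) (eα := natE) (eβ := stIPE)
    (step := fun s j st => roundStepIP s.1 s.2.1 s.2.2.1 s.2.2.2.1 s.2.2.2.2.1 st j)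
    (init := fun s => (s.2.2.2.2.2, true)) roundStepIPC hinit ((3 * X + 3) ^ 2) (fun s l₁ l₂ => runStateIP_length_le s l₁ l₂)
  refine ((h.comp ((fst _ _).pair (urange.comp (snd _ _)))).congr fun p => ?_)
  rfl

/-- Typed input of the instance test: `((1^ℓ, 1ᴰ, 1ᵂ), (t, u₀, φ, K))`. [folklore] -/
abbrev icE : (ℕ × ℕ × ℕ) × (List (List Bool) × ℕ × CNF ℕ × ℤ) → List Bool :=
  pairE (pairE unE (pairE unE unE)) (pairE (rawE strE) (pairE natE (pairE cnfE intE)))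

/-- **The instance test** (`instCheck`) on codes. [cite: AroraBarakCC2009, Thm. 8.21 (proof: polynomial-time verifier)] -/
theorem instCheckC : CodeFP icE bitE (fun p => instCheck p.1.1 p.1.2.1 p.1.2.2 p.2.1 p.2.2.1 p.2.2.2.1 p.2.2.2.2) := by
  have hℓ : CodeFP icE unE (fun p => p.1.1) := (fst _ _).fst'
  have hD : CodeFP icE unE (fun p => p.1.2.1) := (fst _ _).snd'.fst'
  have hW : CodeFP icE unE (fun p => p.1.2.2) := (fst _ _).snd'.snd'
  have ht : CodeFP icE (rawE strE) (fun p => p.2.1) := (snd _ _).fst'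
  have hu₀ : CodeFP icE natE (fun p => p.2.2.1) := (snd _ _).snd'.fst'
  have hφ : CodeFP icE cnfRawE (fun p => p.2.2.2.1) := (cnfRawOfList.comp (snd _ _).snd'.snd'.fst' :)
  have hK : CodeFP icE intE (fun p => p.2.2.2.2) := (snd _ _).snd'.snd'.snd'
  have hvl : CodeFP icE (rawE natE) (fun p => varList p.2.2.2.1) := (varListC.comp hφ :)
  have hk : CodeFP icE unE (fun p => (varList p.2.2.2.1).length) := ((ulength natE).comp hvl :)
  have hctx : CodeFP icE ctxIPE (fun p => (p.1.1, p.1.2.1, p.1.2.2, p.2.1, p.2.2.1, p.2.2.2.2)) :=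
    (hℓ.pair (hD.pair (hW.pair (ht.pair (hu₀.pair hK)))) :)
  have hst : CodeFP icE stIPE (fun p => runRoundsIP p.1.1 p.1.2.1 p.1.2.2 p.2.1 p.2.2.1 p.2.2.2.2 (varList p.2.2.2.1).length) :=
    (runRoundsIPC.comp (hctx.pair hk) :)
  have hch : CodeFP icE (rawE intE) (fun p => chals p.1.1 p.2.1 p.2.2.1 (varList p.2.2.2.1).length) :=
    (chalsC.comp (hℓ.pair (ht.pair (hu₀.pair hk))) :)
  have hA : CodeFP icE assocE (fun p => (varList p.2.2.2.1).zip (chals p.1.1 p.2.1 p.2.2.1 (varList p.2.2.2.1).length)) :=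
    ((rawZip natE intE).comp (hvl.pair hch) :)
  have hval : CodeFP icE intE (fun p => cnfVal (lookupVal ((varList p.2.2.2.1).zip
      (chals p.1.1 p.2.1 p.2.2.1 (varList p.2.2.2.1).length))) p.2.2.2.1) :=
    (cnfValC.comp (hA.pair hφ) :)
  have hfin := hst.snd'.and (intEq.comp (hst.fst'.pair hval))
  exact hfin.congr fun p => by unfold instCheck; rfl

/-! ### The replay and the whole test on codes -/

/-- `stepOK` through the accessors. [folklore] -/
theorem stepOK_eq (x : List Bool) (ans : List (List Bool)) (qn i : ℕ) :
    stepOK M x ans qn i = (isQuery (M.step x (ans.take i)) && decide ((queryOf (M.step x (ans.take i))).length ≤ qn)) := by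
  unfold stepOK isQuery queryOf
  cases M.step x (ans.take i) <;> simp

variable {M}

/-- Typed input of the replay: `(x, ans, 1^{qn})`. [folklore] -/
abbrev rpE : List Bool × List (List Bool) × ℕ → List Bool := pairE strE (pairE (rawE strE) unE)

/-- The step after the first `i` claimed answers, on codes. [cite: AroraBarak2009, §3.4] -/
theorem stepTakeC (hM : M.IsPolyTime encodingBoolBool) :
    CodeFP (pairE rpE natE) stepE (fun q => M.step q.1.1 (q.1.2.1.take q.2)) := by
  have hx : CodeFP (pairE rpE natE) strE (fun q => q.1.1) := (fst _ _).fst'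
  have hans : CodeFP (pairE rpE natE) (rawE strE) (fun q => q.1.2.1) := (fst _ _).snd'.fst'
  have htake : CodeFP (pairE rpE natE) (listE strE) (fun q => q.1.2.1.take q.2) :=
    ((listOfRaw strE).comp ((rawTakeNat strE).comp ((snd _ _).pair hans)) :)
  exact ((stepC M hM).comp (hx.pair htake) :)

/-- **The replay test** (`replayOK`) on codes. [cite: LundEtAl1992, Lemma 3] [cite: AroraBarak2009, §3.4] -/
theorem replayOKC (hM : M.IsPolyTime encodingBoolBool) : CodeFP rpE bitE (fun p => replayOK M p.1 p.2.1 p.2.2) := by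
  have hans : CodeFP rpE (rawE strE) (fun p => p.2.1) := (snd _ _).fst'
  have hqn : CodeFP rpE unE (fun p => p.2.2) := (snd _ _).snd'
  have hlen : CodeFP rpE unE (fun p => p.2.1.length) := ((ulength strE).comp hans :)
  have hle : CodeFP rpE bitE (fun p => decide (p.2.1.length ≤ p.2.2)) := (unLeNat.comp (hlen.pair (natOfUn.comp hqn)) :)
  have hstep := stepTakeC hM
  have hq : CodeFP (pairE rpE natE) bitE (fun q => isQuery (M.step q.1.1 (q.1.2.1.take q.2))) := (isQueryC.comp hstep :)
  have hy : CodeFP (pairE rpE natE) unE (fun q => (queryOf (M.step q.1.1 (q.1.2.1.take q.2))).length) :=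
    (strLength.comp (queryOfC.comp hstep) :)
  have hyle : CodeFP (pairE rpE natE) bitE (fun q => decide ((queryOf (M.step q.1.1 (q.1.2.1.take q.2))).length ≤ q.1.2.2)) :=
    (unLeNat.comp (hy.pair (natOfUn.comp (fst _ _).snd'.snd')) :)
  have hitem : CodeFP (pairE rpE natE) bitE (fun q => stepOK M q.1.1 q.1.2.1 q.1.2.2 q.2) :=
    (hq.and hyle).congr fun q => (stepOK_eq M _ _ _ _).symm
  have hall : CodeFP rpE bitE (fun p => (List.range p.2.1.length).all (stepOK M p.1 p.2.1 p.2.2)) :=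
    ((all (σ := List Bool × List (List Bool) × ℕ) (eσ := rpE) (p := fun q => stepOK M q.1.1 q.1.2.1 q.1.2.2 q.2) hitem).comp
      ((CodeFP.id _).pair (urange.comp hlen))).congr fun p => rfl
  have hlast : CodeFP rpE stepE (fun p => M.step p.1 p.2.1) :=
    ((stepC M hM).comp ((fst _ _).pair ((listOfRaw strE).comp hans)) :)
  have hacc : CodeFP rpE bitE (fun p => decide (M.step p.1 p.2.1 = Sum.inr true)) := (isAcceptC.comp hlast :)
  exact (hle.and (hall.and hacc)).congr fun p => by unfold replayOK; rfl

/-- The `i`-th claim on codes. [folklore] -/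
theorem claimKC : CodeFP (pairE (rawE strE) natE) intE (fun p => claimK p.1 p.2) :=
  (intOfNat.comp (strVal.comp (rawGetD strE (d := ([] : List Bool)) rfl))).congr fun _ => rfl

/-- The canonicity test of the `i`-th claimed answer on codes. [folklore] -/
theorem canonAnsC : CodeFP (pairE (rawE strE) natE) bitE (fun p => canonAns p.1 p.2) := by
  have ha : CodeFP (pairE (rawE strE) natE) strE (fun p => p.1.getD p.2 []) := rawGetD strE (d := ([] : List Bool)) rfl
  have hre : CodeFP (pairE (rawE strE) natE) strE (fun p => natE (bitsToNat (p.1.getD p.2 []))) := (strOfNat.comp (strVal.comp ha) :)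
  exact ((CodeFP.eq (eα := strE) fun a b h => h).comp (hre.pair ha)).congr fun p => by unfold canonAns; rfl

variable {red : List Bool → CNF ℕ}

/-- **The `i`-th instance** (`instOf`) on codes, for a reduction computed on codes. [cite: LundEtAl1992, Lemma 3] -/
theorem instOfC (hM : M.IsPolyTime encodingBoolBool) (hred : CodeFP strE cnfE red) :
    CodeFP (pairE rpE natE) cnfE (fun q => instOf M red q.1.1 q.1.2.1 q.2) := by
  have h := hred.comp (queryOfC.comp (stepTakeC hM))
  exact h.congr fun q => by unfold instOf; rw [qryOf_eq_queryOf]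

/-- Typed input of the referee core: `((1^ℓ, 1ᴰ, 1ᵂ, R, 1^{qn}), (x, t))`. [folklore] -/
abbrev rcE : (ℕ × ℕ × ℕ × ℕ × ℕ) × (List Bool × List (List Bool)) → List Bool :=
  pairE (pairE unE (pairE unE (pairE unE (pairE natE unE)))) (pairE strE (rawE strE))

/-- **The referee's core test** (`refCore`) on codes. [cite: LundEtAl1992, §2 (polynomial-time verifier), Lemma 3, §3]
[cite: AroraBarakCC2009, Thm. 8.21 (proof: polynomial-time verifier)] -/
theorem refCoreC (hM : M.IsPolyTime encodingBoolBool) (hred : CodeFP strE cnfE red) :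
    CodeFP rcE bitE (fun p => refCore M red p.1.1 p.1.2.1 p.1.2.2.1 p.1.2.2.2.1 p.1.2.2.2.2 p.2.1 p.2.2) := by
  have hℓ : CodeFP rcE unE (fun p => p.1.1) := (fst _ _).fst'
  have hD : CodeFP rcE unE (fun p => p.1.2.1) := (fst _ _).snd'.fst'
  have hW : CodeFP rcE unE (fun p => p.1.2.2.1) := (fst _ _).snd'.snd'.fst'
  have hR : CodeFP rcE natE (fun p => p.1.2.2.2.1) := (fst _ _).snd'.snd'.snd'.fst'
  have hqn : CodeFP rcE unE (fun p => p.1.2.2.2.2) := (fst _ _).snd'.snd'.snd'.snd'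
  have hx : CodeFP rcE strE (fun p => p.2.1) := (snd _ _).fst'
  have ht : CodeFP rcE (rawE strE) (fun p => p.2.2) := (snd _ _).snd'
  have hans : CodeFP rcE (rawE strE) (fun p => ansOf p.2.2) := (ansOfC.comp ht :)
  have hrp : CodeFP rcE rpE (fun p => (p.2.1, ansOf p.2.2, p.1.2.2.2.2)) := (hx.pair (hans.pair hqn) :)
  have hrep : CodeFP rcE bitE (fun p => replayOK M p.2.1 (ansOf p.2.2) p.1.2.2.2.2) := ((replayOKC hM).comp hrp :)
  -- the item test, context `p : rcE`, item `i : natE`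
  have hi : CodeFP (pairE rcE natE) natE (fun q => q.2) := snd _ _
  have hansq : CodeFP (pairE rcE natE) (rawE strE) (fun q => ansOf q.1.2.2) := (hans.comp (fst _ _) :)
  have hcan : CodeFP (pairE rcE natE) bitE (fun q => canonAns (ansOf q.1.2.2) q.2) := (canonAnsC.comp (hansq.pair hi) :)
  have hK : CodeFP (pairE rcE natE) intE (fun q => claimK (ansOf q.1.2.2) q.2) := (claimKC.comp (hansq.pair hi) :)
  have hφ : CodeFP (pairE rcE natE) cnfE (fun q => instOf M red q.1.2.1 (ansOf q.1.2.2) q.2) :=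
    ((instOfC hM hred).comp ((hrp.comp (fst _ _)).pair hi) :)
  have hu₀ : CodeFP (pairE rcE natE) natE (fun q => q.2 * q.1.1.2.2.2.1) := (natMul.comp (hi.pair (hR.comp (fst _ _))) :)
  have hic : CodeFP (pairE rcE natE) icE (fun q => ((q.1.1.1, q.1.1.2.1, q.1.1.2.2.1),
      (q.1.2.2, q.2 * q.1.1.2.2.2.1, instOf M red q.1.2.1 (ansOf q.1.2.2) q.2, claimK (ansOf q.1.2.2) q.2))) :=
    (((hℓ.comp (fst _ _)).pair ((hD.comp (fst _ _)).pair (hW.comp (fst _ _)))).pair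
      ((ht.comp (fst _ _)).pair (hu₀.pair (hφ.pair hK))) :)
  have hinst : CodeFP (pairE rcE natE) bitE (fun q => instCheck q.1.1.1 q.1.1.2.1 q.1.1.2.2.1 q.1.2.2 (q.2 * q.1.1.2.2.2.1)
      (instOf M red q.1.2.1 (ansOf q.1.2.2) q.2) (claimK (ansOf q.1.2.2) q.2)) :=
    (instCheckC.comp hic :)
  have hitem := hcan.and hinst
  have hall : CodeFP rcE bitE (fun p => (List.range (ansOf p.2.2).length).all fun i =>
      canonAns (ansOf p.2.2) i && instCheck p.1.1 p.1.2.1 p.1.2.2.1 p.2.2 (i * p.1.2.2.2.1)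
        (instOf M red p.2.1 (ansOf p.2.2) i) (claimK (ansOf p.2.2) i)) :=
    ((all hitem).comp ((CodeFP.id _).pair (urange.comp ((ulength strE).comp hans)))).congr fun p => rfl
  exact (hrep.and hall).congr fun p => by unfold refCore; rfl

/-! ### The parameters as polynomials of the input length -/

section Params

variable (q pr : Polynomial ℕ) (c : ℕ)

/-- `N(n) = pr(q(n))`: a bound on the code length of every instance `φᵢ` (the reduction's output
length `pr` at the query length `q(n)`); also the number `R` of round slots per instance.
[cite: AroraBarakCC2009, Thm. 8.21 (proof: `n` rounds for `n` variables)] -/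
def Npoly : Polynomial ℕ := pr.comp q

/-- `ℓ(n) = n^c + N(n) + 3`: challenge bits (so that `(n^c + 1) · N(n) / 2^ℓ ≤ 1/8`).
[cite: AroraBarakCC2009, Thm. 8.21 (proof: error `≤ dn/p`)] -/
def ellPoly : Polynomial ℕ := X ^ c + Npoly q pr + 3

/-- `D(n) = N(n) + 1`: transmitted coefficients (degree `≤ size φ ≤ N`). [cite: AroraBarakCC2009, §8.3.2] -/
def Dpoly : Polynomial ℕ := Npoly q pr + 1

/-- `W(n) = N + (ℓ+3)N + N + 2`: width of a coefficient (`natAbs_coeff_h_lt_of_le`). [folklore] -/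
def Wpoly : Polynomial ℕ := Npoly q pr + (ellPoly q pr c + 3) * Npoly q pr + Npoly q pr + 2

/-- `A(n) = 2·q(n)·(2N(n)+4) + 2`: a bound on the length of the honest answers message. [folklore] -/
def Apoly : Polynomial ℕ := 2 * (q * (2 * Npoly q pr + 4)) + 2

/-- `m(n) = D(n)·W(n) + A(n) + ℓ(n)`: the common message length of the protocol (room for a polynomial
message, for the answers message, and at least `ℓ` challenge bits). [folklore] -/
def mPoly : Polynomial ℕ := Dpoly q pr * Wpoly q pr c + Apoly q pr + ellPoly q pr c

/-- Unfolding `ellPoly`. [folklore] -/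
theorem eval_ellPoly (n : ℕ) : (ellPoly q pr c).eval n = n ^ c + (Npoly q pr).eval n + 3 := by simp [ellPoly]

/-- Unfolding `Dpoly`. [folklore] -/
theorem eval_Dpoly (n : ℕ) : (Dpoly q pr).eval n = (Npoly q pr).eval n + 1 := by simp [Dpoly]

/-- Unfolding `Wpoly`. [folklore] -/
theorem eval_Wpoly (n : ℕ) : (Wpoly q pr c).eval n =
    (Npoly q pr).eval n + ((ellPoly q pr c).eval n + 3) * (Npoly q pr).eval n + (Npoly q pr).eval n + 2 := by
  simp [Wpoly]

/-- Unfolding `Apoly`. [folklore] -/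
theorem eval_Apoly (n : ℕ) : (Apoly q pr).eval n = 2 * (q.eval n * (2 * (Npoly q pr).eval n + 4)) + 2 := by
  simp [Apoly]

/-- Unfolding `mPoly`. [folklore] -/
theorem eval_mPoly (n : ℕ) : (mPoly q pr c).eval n =
    (Dpoly q pr).eval n * (Wpoly q pr c).eval n + (Apoly q pr).eval n + (ellPoly q pr c).eval n := by
  simp [mPoly]

/-- Unfolding `Npoly`. [folklore] -/
theorem eval_Npoly (n : ℕ) : (Npoly q pr).eval n = pr.eval (q.eval n) := by simp [Npoly, eval_comp]

end Params

/-! ### The referee language -/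

section RefLang

variable (M) (red) (L : Language Bool) (q pr : Polynomial ℕ) (c n₀ : ℕ)

/-- **The referee's test for long inputs**: `refCore` with the parameters `ℓ(n), D(n), W(n), R = N(n),
qn = q(n)` of `n = |x|`, on the view `⟨x, ⟨1^{|t|}, encList t⟩⟩` of the public-coin verifier
(`AMasIP.verdictL`). [cite: LundEtAl1992, §3 (proof of Thm. 1: the protocol)] -/
def RefMain : Language Bool :=
  {z | refCore M red ((ellPoly q pr c).eval (fstF z).length) ((Dpoly q pr).eval (fstF z).length)
    ((Wpoly q pr c).eval (fstF z).length) ((Npoly q pr).eval (fstF z).length) (q.eval (fstF z).length)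
    (fstF z) (decNil (sndF (sndF z))) = true}

/-- The views with an input component of length `≥ n₀`. [folklore] -/
def LongInputs : Language Bool := {z | n₀ ≤ (fstF z).length}

/-- The views whose input component is a member of `L` of length `< n₀`. [folklore] -/
def ShortMembers : Language Bool := {z | fstF z ∈ L ∧ (fstF z).length < n₀}

/-- **The referee language**: the protocol's test on inputs of length `≥ n₀`, and the table of `L` on
the finitely many shorter inputs (for which `n^c` messages do not suffice). [cite: LundEtAl1992, §3]
[cite: AroraBarak2009, §1.3 (hardwiring finitely many inputs)] -/
def Ref : Language Bool :=
  caseSplit (LongInputs n₀) (RefMain M red q pr c) (ShortMembers L n₀)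

variable {M red L q pr c n₀}

/-- Membership in `RefMain`. [folklore] -/
theorem mem_RefMain_iff (z : List Bool) : z ∈ RefMain M red q pr c ↔
    refCore M red ((ellPoly q pr c).eval (fstF z).length) ((Dpoly q pr).eval (fstF z).length)
      ((Wpoly q pr c).eval (fstF z).length) ((Npoly q pr).eval (fstF z).length) (q.eval (fstF z).length)
      (fstF z) (decNil (sndF (sndF z))) = true := Iff.rfl

/-- Membership in `LongInputs`. [folklore] -/
theorem mem_LongInputs_iff (z : List Bool) : z ∈ LongInputs n₀ ↔ n₀ ≤ (fstF z).length := Iff.rfl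

/-- Membership in `ShortMembers`. [folklore] -/
theorem mem_ShortMembers_iff (z : List Bool) : z ∈ ShortMembers L n₀ ↔ fstF z ∈ L ∧ (fstF z).length < n₀ := Iff.rfl

/-- The view of the public-coin verifier parses as intended. [folklore] -/
theorem decNil_sndF_encMoves (t : List (List Bool)) : decNil (sndF ((encodingList Bool).listBool.encode t)) = t := by
  rw [show ((encodingList Bool).listBool.encode : List (List Bool) → List Bool) = listE strE from listE_eq (encodingList Bool)]
  simp [listE]

/-- **On long inputs the referee runs `refCore`.** [cite: LundEtAl1992, §3] -/
theorem mem_Ref_iff_of_le {x : List Bool} (hx : n₀ ≤ x.length) (t : List (List Bool)) :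
    boolPair x ((encodingList Bool).listBool.encode t) ∈ Ref M red L q pr c n₀ ↔
      refCore M red ((ellPoly q pr c).eval x.length) ((Dpoly q pr).eval x.length) ((Wpoly q pr c).eval x.length)
        ((Npoly q pr).eval x.length) (q.eval x.length) x t = true := by
  rw [Ref, mem_caseSplit_iff, mem_RefMain_iff, mem_LongInputs_iff, mem_ShortMembers_iff, fstF_boolPair, sndF_boolPair,
    decNil_sndF_encMoves]
  exact ⟨fun h => h.1 hx, fun h => ⟨fun _ => h, fun h' => absurd hx h'⟩⟩

/-- **On short inputs the referee decides `L` by itself.** [cite: AroraBarak2009, §1.3] -/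
theorem mem_Ref_iff_of_lt {x : List Bool} (hx : x.length < n₀) (y : List Bool) :
    boolPair x y ∈ Ref M red L q pr c n₀ ↔ x ∈ L := by
  rw [Ref, mem_caseSplit_iff, mem_LongInputs_iff, mem_ShortMembers_iff, fstF_boolPair]
  exact ⟨fun h => (h.2 (by omega)).1, fun h => ⟨fun h' => absurd hx (by omega), fun _ => ⟨h, hx⟩⟩⟩

/-- A language cut out by a typed polynomial-time bit is in `P`. [cite: AroraBarak2009, Def. 1.13] -/
theorem setOf_codeFP_mem_P {p : List Bool → Bool} (h : CodeFP strE bitE p) : ({z | p z = true} : Language Bool) ∈ Classes.P := by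
  obtain ⟨F, hF, hFs⟩ := h
  refine mem_P_of_mem_FP hF _ fun z => ⟨fun hz => ?_, fun hz => ?_⟩
  · rw [show F z = bitE (p z) from hFs z, show p z = true from hz]; rfl
  · rw [show F z = bitE (p z) from hFs z, Bool.eq_false_iff.2 hz]; rfl

/-- The short part of any language is in `P` (a finite table; `shortPart_mem_P` of
`BPPSubsetAlmostP.lean`, re-proved here to keep the imports of the complexity core small). [folklore] -/
theorem shortPart_mem_P' (n₀ : ℕ) : ({x | x ∈ L ∧ x.length < n₀} : Language Bool) ∈ Classes.P := by
  classical
  refine mem_P_of_mem_FP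
    (g := fun x => if n₀ ≤ x.length then [false] else encodeBool (L.boolIndicator x))
    (mem_FP_of_eqOn_le (const_mem_FP [false]) n₀ fun z hz => if_pos hz) _ fun w => ⟨fun hw => ?_, fun hw => ?_⟩
  · obtain ⟨hwL, hwn⟩ := hw
    show (if n₀ ≤ w.length then [false] else encodeBool (L.boolIndicator w)) = [true]
    rw [if_neg (Nat.not_le.2 hwn), (Set.mem_iff_boolIndicator _ _).1 hwL]; rfl
  · show (if n₀ ≤ w.length then [false] else encodeBool (L.boolIndicator w)) = [false]
    by_cases hn : n₀ ≤ w.length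
    · rw [if_pos hn]
    · rw [if_neg hn]
      have hwL : w ∉ L := fun h => hw ⟨h, Nat.not_le.1 hn⟩
      rw [(Set.notMem_iff_boolIndicator _ _).1 hwL]; rfl

/-- **`RefMain ∈ P`** for a polynomial-time `M` and a reduction computed on codes.
[cite: LundEtAl1992, §2 ("a polynomial-time, probabilistic Turing machine")] [cite: AroraBarakCC2009, Thm. 8.21 (proof)] -/
theorem RefMain_mem_P (hM : M.IsPolyTime encodingBoolBool) (hred : CodeFP strE cnfE red) :
    RefMain M red q pr c ∈ Classes.P := by
  have hx : CodeFP strE strE fstF := of_fn fstF fstF_mem_FP fun _ => rfl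
  have ht : CodeFP strE (rawE strE) (fun z => decNil (sndF (sndF z))) :=
    (decNilC.comp (of_fn (sndF ∘ sndF) (comp_mem_FP sndF_mem_FP sndF_mem_FP) fun _ => rfl : CodeFP strE strE (sndF ∘ sndF))).congr
      fun _ => rfl
  have hP : ∀ Q : Polynomial ℕ, CodeFP strE unE (fun z => Q.eval (fstF z).length) := fun Q => (polyU Q).comp hx
  have hR : CodeFP strE natE (fun z => (Npoly q pr).eval (fstF z).length) := (natOfUn.comp (hP _) :)
  have harg : CodeFP strE rcE (fun z => (((ellPoly q pr c).eval (fstF z).length, (Dpoly q pr).eval (fstF z).length,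
      (Wpoly q pr c).eval (fstF z).length, (Npoly q pr).eval (fstF z).length, q.eval (fstF z).length), (fstF z, decNil (sndF (sndF z))))) :=
    (((hP _).pair ((hP _).pair ((hP _).pair (hR.pair (hP _))))).pair (hx.pair ht) :)
  exact setOf_codeFP_mem_P ((refCoreC hM hred).comp harg)

/-- **`Ref ∈ P`.** [cite: LundEtAl1992, §2] [cite: AroraBarak2009, §1.3] -/
theorem Ref_mem_P (hM : M.IsPolyTime encodingBoolBool) (hred : CodeFP strE cnfE red) :
    Ref M red L q pr c n₀ ∈ Classes.P := by
  have hx : CodeFP strE strE fstF := of_fn fstF fstF_mem_FP fun _ => rfl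
  have hS : LongInputs n₀ ∈ Classes.P := by
    have h : CodeFP strE bitE (fun z => decide (n₀ ≤ (fstF z).length)) := (natLeUn.comp ((const _ n₀).pair (strLength.comp hx)) :)
    have hP := setOf_codeFP_mem_P h
    have heq : LongInputs n₀ = ({z | decide (n₀ ≤ (fstF z).length) = true} : Language Bool) := by
      ext z; rw [mem_LongInputs_iff]; exact (decide_eq_true_iff (p := n₀ ≤ (fstF z).length)).symm
    rwa [heq]
  have hshort : ShortMembers L n₀ ∈ Classes.P :=
    preimage_mem_P (shortPart_mem_P' (L := L) n₀) fstF_mem_FP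
  exact caseSplit_mem_P hS (RefMain_mem_P hM hred) hshort

end RefLang

/-! ### The public-coin verifier with polynomially many messages -/

section Verifier

variable (Ref : Language Bool) (m : Polynomial ℕ) (c : ℕ)

/-- **The verifier**: `n^c` messages of length `m(n)`, `(n^c + 1) · m(n)` private coins sent in the
clear — its message at a history of length `j` is coin block `j` (`AMasIP.nextF`) — and the verdict
of the referee `Ref` on `⟨x, enc transcript⟩` (`AMasIP.verdictL`): Arthur of `ArthurMerlinGamesIPProofs.lean`
with a polynomial instead of a constant number of messages. [cite: LundEtAl1992, §2–§3 (Vanna's messages are her random choices)]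
[cite: AroraBarakCC2009, §8.2.1 (public coins)] -/
def pubVerifier : IPVerifier :=
  ⟨(X ^ c + 1) * m, m, AMasIP.nextF m, AMasIP.verdictL Ref⟩

/-- The fields of the verifier. [folklore] -/
theorem pubVerifier_next : (pubVerifier Ref m c).next = AMasIP.nextF m := by simp only [pubVerifier]
/-- The fields of the verifier. [folklore] -/
theorem pubVerifier_verdict : (pubVerifier Ref m c).verdict = AMasIP.verdictL Ref := by simp only [pubVerifier]
/-- The fields of the verifier. [folklore] -/
theorem pubVerifier_msgLen : (pubVerifier Ref m c).msgLen = m := by simp only [pubVerifier]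
/-- The fields of the verifier. [folklore] -/
theorem pubVerifier_coins (n : ℕ) : (pubVerifier Ref m c).coins.eval n = (n ^ c + 1) * m.eval n := by
  simp only [pubVerifier]; simp

variable {Ref} in
/-- The verifier is probabilistic polynomial time when the referee is in `P`. [cite: AroraBarakCC2009, Def. 8.6] -/
theorem pubVerifier_isPolyTime (hRef : Ref ∈ Classes.P) : (pubVerifier Ref m c).IsPolyTime := by
  refine ⟨?_, ?_⟩
  · rw [pubVerifier_next]; exact AMasIP.nextF_mem_FP m
  · rw [pubVerifier_verdict]; exact AMasIP.verdictL_mem_P hRef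

/-- **The next message** after the history `t` (all messages normalised to length `mh`): at the
verifier's turns (even `|t|`) the coin block `|t|`, otherwise the prover's reply. [cite: AroraBarakCC2009, Def. 8.6 with §8.2.1] -/
def nextMsg (mh : ℕ) (r : List Bool) (P : IPProver) (t : List (List Bool)) : List Bool :=
  if t.length % 2 = 0 then (block mh t.length r).takeD mh false else (P t).takeD mh false

/-- **The public transcript** of `j` messages, built one message at a time from the root.
[cite: AroraBarakCC2009, Def. 8.6] -/
def pubT (mh : ℕ) (r : List Bool) (P : IPProver) : ℕ → List (List Bool)
  | 0 => []
  | j + 1 => pubT mh r P j ++ [nextMsg mh r P (pubT mh r P j)]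

variable (mh : ℕ) (r : List Bool) (P : IPProver)

/-- `pubT j` has `j` messages. [folklore] -/
@[simp] theorem length_pubT : ∀ j : ℕ, (pubT mh r P j).length = j
  | 0 => rfl
  | j + 1 => by rw [pubT, List.length_append, length_pubT j]; rfl

/-- **The public transcript is prefix-closed.** [folklore] -/
theorem take_pubT : ∀ {i j : ℕ}, i ≤ j → (pubT mh r P j).take i = pubT mh r P i
  | i, 0, h => by obtain rfl : i = 0 := Nat.le_zero.1 h; rfl
  | i, j + 1, h => by
    rcases Nat.lt_or_ge i (j + 1) with hi | hi
    · rw [pubT, List.take_append_of_le_length (by rw [length_pubT]; omega)]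
      exact take_pubT (by omega)
    · obtain rfl : i = j + 1 := le_antisymm h hi
      exact List.take_of_length_le (by rw [length_pubT])

/-- Message `i` of the public transcript is the next message after its first `i` messages. [folklore] -/
theorem getD_pubT {i j : ℕ} (h : i < j) : (pubT mh r P j).getD i [] = nextMsg mh r P (pubT mh r P i) := by
  have ht := take_pubT mh r P (show i + 1 ≤ j from h)
  rw [pubT] at ht
  have h1 : ((pubT mh r P j).take (i + 1)).getD i [] = (pubT mh r P j).getD i [] := by
    rw [List.getD_eq_getElem?_getD, List.getD_eq_getElem?_getD, List.getElem?_take_of_lt (Nat.lt_succ_self i)]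
  rw [← h1, ht, List.getD_eq_getElem?_getD, List.getElem?_append_right (by rw [length_pubT]), length_pubT, Nat.sub_self]
  rfl

/-- **The interaction of the verifier with any prover is the public transcript**: continuing from
`pubT j` for `k` more messages gives `pubT (j + k)`. [cite: AroraBarakCC2009, Def. 8.6 with §8.2.1] -/
theorem transcriptAux_eq_pubT (x : List Bool) : ∀ (k j : ℕ),
    (pubVerifier Ref m c).transcriptAux x r P (m.eval x.length) (decide (j % 2 = 0)) k (pubT (m.eval x.length) r P j) =
      pubT (m.eval x.length) r P (j + k)
  | 0, j => by rw [AMasIP.transcriptAux_zero, Nat.add_zero]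
  | k + 1, j => by
    by_cases hj : j % 2 = 0
    · rw [decide_eq_true hj, AMasIP.transcriptAux_true_succ, pubVerifier_next, AMasIP.nextF_view, length_pubT]
      have hnext : pubT (m.eval x.length) r P j ++ [(block (m.eval x.length) j r).takeD (m.eval x.length) false] =
          pubT (m.eval x.length) r P (j + 1) := by
        rw [pubT, nextMsg, length_pubT, if_pos hj]
      have hpar : false = decide ((j + 1) % 2 = 0) := by rw [decide_eq_false]; omega
      rw [hnext, hpar, transcriptAux_eq_pubT x k (j + 1), Nat.add_right_comm, Nat.add_assoc]
    · rw [decide_eq_false hj, AMasIP.transcriptAux_false_succ]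
      have hnext : pubT (m.eval x.length) r P j ++ [(P (pubT (m.eval x.length) r P j)).takeD (m.eval x.length) false] =
          pubT (m.eval x.length) r P (j + 1) := by
        rw [pubT, nextMsg, length_pubT, if_neg hj]
      have hpar : true = decide ((j + 1) % 2 = 0) := by rw [decide_eq_true]; omega
      rw [hnext, hpar, transcriptAux_eq_pubT x k (j + 1), Nat.add_right_comm, Nat.add_assoc]

/-- **The transcript is the public transcript from the root.** [cite: AroraBarakCC2009, Def. 8.6] -/
theorem transcript_eq_pubT (k : ℕ) (x : List Bool) :
    (pubVerifier Ref m c).transcript k x r P = pubT (m.eval x.length) r P k := by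
  have h := transcriptAux_eq_pubT Ref m c r P x k 0
  rw [Nat.zero_add] at h
  rw [← h]
  rfl

/-- **Acceptance is the referee's verdict on the public transcript.** [cite: AroraBarakCC2009, §8.2.1] -/
theorem accepts_iff (k : ℕ) (x : List Bool) :
    (pubVerifier Ref m c).Accepts k x r P ↔
      boolPair x ((encodingList Bool).listBool.encode (pubT (m.eval x.length) r P k)) ∈ Ref := by
  unfold IPVerifier.Accepts
  rw [pubVerifier_verdict, AMasIP.view_mem_verdictL_iff, transcript_eq_pubT]

/-- The public transcript depends on the coins only through the blocks before its length. [folklore] -/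
theorem pubT_congr {r r' : List Bool} {p : ℕ} (hrr' : ∀ j < p, block mh j r = block mh j r') :
    ∀ {j : ℕ}, j ≤ p → pubT mh r P j = pubT mh r' P j
  | 0, _ => rfl
  | j + 1, hj => by
    have ih := pubT_congr hrr' (Nat.le_of_succ_le hj)
    rw [pubT, pubT, ih]
    unfold nextMsg
    rw [length_pubT, hrr' j hj]

/-- Blocks before position `p` are blocks of the prefix of length `p · mh`. [folklore] -/
theorem block_take {j p : ℕ} (hj : j < p) : block mh j (r.take (p * mh)) = block mh j r := by
  unfold block
  rw [List.drop_take, List.take_take, min_eq_left]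
  have : (j + 1) * mh ≤ p * mh := Nat.mul_le_mul_right mh hj
  rw [Nat.succ_mul] at this
  omega

/-- Hence the first `p` messages are determined by the first `p · mh` coins. [folklore] -/
theorem pubT_take_coins (p : ℕ) : pubT mh (r.take (p * mh)) P p = pubT mh r P p :=
  pubT_congr mh P (fun _ hj => block_take mh r hj) le_rfl

end Verifier

/-! ### The referee's data on a prefix of the transcript -/

section Prefix

variable {α : Type}

/-- Indexing a prefix inside its range. [folklore] -/
theorem getD_take_of_lt (l : List α) (d : α) {i p : ℕ} (h : i < p) : (l.take p).getD i d = l.getD i d := by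
  rw [List.getD_eq_getElem?_getD, List.getD_eq_getElem?_getD, List.getElem?_take_of_lt h]

variable {t : List (List Bool)} {p : ℕ}

/-- The polynomial message of round `u` lies before position `p > 2u + 3`. [folklore] -/
theorem polyMsg_take {u : ℕ} (h : 2 * u + 3 < p) : polyMsg (t.take p) u = polyMsg t u := getD_take_of_lt t [] h

/-- The challenge block of round `u` lies before position `p > 2u + 4`. [folklore] -/
theorem chalBlk_take {u : ℕ} (h : 2 * u + 4 < p) : chalBlk (t.take p) u = chalBlk t u := getD_take_of_lt t [] h

/-- The challenges of the rounds `u₀, …, u₀ + k - 1` lie before position `p ≥ 2(u₀ + k) + 3`. [folklore] -/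
theorem chals_take {ℓ u₀ k : ℕ} (h : 2 * (u₀ + k) + 3 ≤ p) : chals ℓ (t.take p) u₀ k = chals ℓ t u₀ k := by
  unfold chals chalVal
  refine List.map_congr_left fun j hj => ?_
  rw [chalBlk_take]
  have := List.mem_range.1 hj
  omega

/-- The claimed answers lie at position `1 < p`. [folklore] -/
theorem ansOf_take (h : 1 < p) : ansOf (t.take p) = ansOf t := by
  unfold ansOf; rw [getD_take_of_lt t [] h]

/-- The decoded strategy of round `u₀ + j` lies before position `p > 2(u₀ + j) + 3`. [folklore] -/
theorem stratIP_take {D W u₀ j : ℕ} (h : 2 * (u₀ + j) + 3 < p) : stratIP D W (t.take p) u₀ j = stratIP D W t u₀ j := by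
  unfold stratIP; rw [polyMsg_take h]

end Prefix

/-! ### Bad coin blocks and the soundness estimate -/

section Soundness

variable (M : OracleAlg Bool) (red : List Bool → CNF ℕ) (x : List Bool) (ℓ D W R : ℕ)

/-- **The difference polynomial of instance `i`, round `j`**: the prover's decoded polynomial minus
the honest `h` at the earlier challenges of the instance. [cite: AroraBarakCC2009, Thm. 8.21 (proof of the Claim: `s(X₁) - h(X₁)`)] -/
def badPoly (t : List (List Bool)) (i j : ℕ) : ℤ[X] :=
  stratIP D W t (i * R) j - h (instOf M red x (ansOf t) i) (varList (instOf M red x (ansOf t) i)) (chals ℓ t (i * R) j)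

variable {M red x ℓ D W R} in
/-- The difference polynomial of the round challenged at position `p = 2(iR + j) + 4` is determined by
the messages before `p`. [folklore] -/
theorem badPoly_take {t : List (List Bool)} {i j p : ℕ} (h : 2 * (i * R + j) + 4 ≤ p) :
    badPoly M red x ℓ D W R (t.take p) i j = badPoly M red x ℓ D W R t i j := by
  unfold badPoly
  rw [stratIP_take (by omega), ansOf_take (by omega), chals_take (by omega)]

variable (N mh : ℕ) (P : IPProver)

/-- The difference polynomial examined at coin block `p`, computed from the earlier coins `w`: the
round is `u = (p - 4)/2`, the instance `u / R` and its round `u % R`, the transcript the public one on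
`w`. [cite: AroraBarakCC2009, Thm. 8.21 (proof of the Claim)] -/
def badQ (p : ℕ) (w : List Bool) : ℤ[X] :=
  badPoly M red x ℓ D W R (pubT mh w P p) ((p - 4) / 2 / R) ((p - 4) / 2 % R)

/-- **The bad set of coin block `p` given the earlier coins `w`**: at a challenge position
(`p = 2u + 4`), the blocks whose challenge value is a root of the nonzero, low-degree difference
polynomial of that round; empty at the other positions. [cite: AroraBarakCC2009, Thm. 8.21 (proof: "at most `d` values `a` such that `s(a) = h(a)`")] -/
def badSetIP (p : ℕ) (w : List Bool) : Set (List Bool) :=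
  if p % 2 = 0 ∧ 4 ≤ p then
    {blk | badQ M red x ℓ D W R mh P p w ≠ 0 ∧ (badQ M red x ℓ D W R mh P p w).natDegree ≤ N ∧
      (badQ M red x ℓ D W R mh P p w).IsRoot (bitsToNat ((blk.takeD mh false).take ℓ) : ℤ)}
  else ∅

variable {M red x ℓ D W R N mh P}

/-- **Each bad set is small**: probability `≤ N / 2^ℓ` over a uniform block of length `mh ≥ ℓ` (at most
`N` roots, read off the first `ℓ` fresh bits; `uniformProb_isRoot_le`). [cite: AroraBarakCC2009, Thm. 8.21 (proof of the Claim)] -/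
theorem uniformProb_badSetIP_le (hℓ : ℓ ≤ mh) (p : ℕ) (w : List Bool) :
    uniformProb mh (badSetIP M red x ℓ D W R N mh P p w) ≤ N / 2 ^ ℓ := by
  have h0 : (0 : ℝ) ≤ N / 2 ^ ℓ := by positivity
  unfold badSetIP
  split_ifs with hp
  · set Q := badQ M red x ℓ D W R mh P p w with hQ
    by_cases hgood : Q ≠ 0 ∧ Q.natDegree ≤ N
    · have hsub : {blk : List Bool | Q ≠ 0 ∧ Q.natDegree ≤ N ∧ Q.IsRoot (bitsToNat ((blk.takeD mh false).take ℓ) : ℤ)} ⊆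
          {blk | Q.IsRoot (bitsToNat ((blk.takeD mh false).take ℓ) : ℤ)} := fun blk hblk => hblk.2.2
      refine (uniformProb_mono' hsub).trans ?_
      rw [uniformProb_congr_len (E' := {blk : List Bool | (blk.drop 0).take ℓ ∈ {b : List Bool | Q.IsRoot (bitsToNat b : ℤ)}})
        (fun blk hblk => by
          simp only [Set.mem_setOf_eq, List.drop_zero]
          rw [List.takeD_eq_take _ hblk.ge, List.take_of_length_le hblk.le])]
      have hb := uniformProb_block_le (a := 0) (ℓ := ℓ) (d := mh - ℓ) (fun _ : List Bool => {b : List Bool | Q.IsRoot (bitsToNat b : ℤ)})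
        (δ := N / 2 ^ ℓ) (fun _ _ => uniformProb_isRoot_le hgood.1 hgood.2)
      rwa [Nat.zero_add, Nat.add_sub_cancel' hℓ] at hb
    · have hempty : {blk : List Bool | Q ≠ 0 ∧ Q.natDegree ≤ N ∧ Q.IsRoot (bitsToNat ((blk.takeD mh false).take ℓ) : ℤ)} = ∅ :=
        Set.eq_empty_iff_forall_notMem.2 fun blk hblk => hgood ⟨hblk.1, hblk.2.1⟩
      rw [hempty, uniformProb_empty]
      exact h0
  · rw [uniformProb_empty]; exact h0

/-- **An accepted transcript has a bad coin block** (for `x ∉ L`): by `exists_badRound_of_refCore` some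
instance `i` (of code length `≤ N`, so `j < |varList φᵢ| ≤ N = R`) has a bad round `j`; its challenge is
coin block `p = 2(iN + j) + 4 < k`, which therefore lies in the bad set computed from the coins before
it. [cite: LundEtAl1992, §3 (proof of Thm. 1, (2))] [cite: AroraBarakCC2009, Thm. 8.21 (proof of the Claim)] -/
theorem exists_badBlock_of_refCore {f : List Bool → ℕ} {L : Language Bool} (hred : ∀ y, (red y).numSat = f y)
    {qn k : ℕ} (hN : ∀ y : List Bool, y.length ≤ qn → (encodingCNF.encode (red y)).length ≤ N)
    (hrun : M.run (Oracle.ofFun f) qn x = some (L.boolIndicator x)) (hx : x ∉ L) (hk : 2 * (qn * N) + 5 ≤ k)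
    (hD : D = N + 1) {r : List Bool} (hacc : refCore M red ℓ D W N qn x (pubT mh r P k) = true) :
    ∃ p < k + 1, (r.drop (p * mh)).take mh ∈ badSetIP M red x ℓ D W N N mh P p (r.take (p * mh)) := by
  set T := pubT mh r P k with hT
  obtain ⟨i, hi, j, hj, hs, hroot⟩ := exists_badRound_of_refCore hred hrun hx hacc
  obtain ⟨hrep, -⟩ := (refCore_eq_true_iff M red ℓ D W N qn x T).1 hacc
  obtain ⟨hlen, hsteps, -⟩ := (replayOK_eq_true_iff M x (ansOf T) qn).1 hrep
  set φ := instOf M red x (ansOf T) i with hφ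
  -- sizes
  have hNi : (encodingCNF.encode φ).length ≤ N := by
    obtain ⟨y, hy, hyq⟩ := hsteps i hi
    have : φ = red y := by rw [hφ, instOf, PRelSigma.qryOf_eq_of_step_eq hy]
    rw [this]
    exact hN y hyq
  have hjN : j < N := hj.trans_le ((length_varList_le_length_encode φ).trans hNi)
  have hNpos : 0 < N := by omega
  set u := i * N + j with hu
  have hui : u / N = i := by rw [hu, Nat.add_comm, Nat.add_mul_div_right _ _ hNpos, Nat.div_eq_of_lt hjN, Nat.zero_add]
  have huj : u % N = j := by rw [hu, Nat.add_comm, Nat.add_mul_mod_self_right, Nat.mod_eq_of_lt hjN]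
  have huk : 2 * u + 4 < k := by
    have h1 : (i + 1) * N ≤ qn * N := Nat.mul_le_mul_right N (by omega)
    rw [Nat.succ_mul] at h1
    omega
  set p := 2 * u + 4 with hp
  refine ⟨p, by omega, ?_⟩
  have hpc : p % 2 = 0 ∧ 4 ≤ p := ⟨by omega, by omega⟩
  have hpu : (p - 4) / 2 = u := by omega
  unfold badSetIP
  rw [if_pos hpc, Set.mem_setOf_eq]
  have hQ : badQ M red x ℓ D W N mh P p (r.take (p * mh)) = badPoly M red x ℓ D W N T i j := by
    unfold badQ
    rw [pubT_take_coins, hpu, hui, huj, ← take_pubT mh r P huk.le, badPoly_take (by omega)]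
  rw [hQ]
  refine ⟨sub_ne_zero.2 hs, ?_, ?_⟩
  · refine (natDegree_sub_le _ _).trans (max_le ?_ ?_)
    · exact (natDegree_stratIP_le _ _ _ _ _).trans (by omega)
    · exact (natDegree_h_le _ _ _).trans ((size_le_length_encode φ).1.trans hNi)
  · have hblk : chalBlk T u = ((r.drop (p * mh)).take mh).takeD mh false := by
      unfold chalBlk
      rw [hT, getD_pubT mh r P huk, nextMsg, length_pubT, if_pos hpc.1]
      rfl
    have hval : chalVal ℓ T (i * N + j) = (bitsToNat ((((r.drop (p * mh)).take mh).takeD mh false).take ℓ) : ℤ) := by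
      unfold chalVal; rw [← hu, hblk]
    rw [← hval]
    exact hroot

/-- The final numerics: `(k + 1) · N / 2^{k + N + 3} ≤ 1/3`. [folklore] -/
theorem soundness_numerics (k N : ℕ) : ((k + 1 : ℕ) : ℝ) * (N / 2 ^ (k + N + 3)) ≤ 1 / 3 := by
  have h1 : ((k + 1 : ℕ) : ℝ) ≤ 2 ^ k := by exact_mod_cast Nat.lt_two_pow_self
  have h2 : (N : ℝ) ≤ 2 ^ N := by exact_mod_cast Nat.lt_two_pow_self.le
  have hpos : (0 : ℝ) < 2 ^ (k + N + 3) := by positivity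
  rw [mul_div_assoc', div_le_div_iff₀ hpos (by norm_num : (0 : ℝ) < 3)]
  have : (2 : ℝ) ^ (k + N + 3) = 8 * (2 ^ k * 2 ^ N) := by rw [pow_add, pow_add]; ring
  rw [this]
  have hk0 : (0 : ℝ) ≤ ((k + 1 : ℕ) : ℝ) := Nat.cast_nonneg _
  nlinarith [mul_le_mul h1 h2 (Nat.cast_nonneg N) (by positivity)]

end Soundness

/-! ### The honest prover and the completeness of the protocol -/

section Honest

/-- Padding a message with `0`s to the common length `mh`. [folklore] -/
def padMsg (mh : ℕ) (s : List Bool) : List Bool := s ++ List.replicate (mh - s.length) false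

/-- A padded short message has the common length. [folklore] -/
theorem length_padMsg {mh : ℕ} {s : List Bool} (h : s.length ≤ mh) : (padMsg mh s).length = mh := by
  unfold padMsg; rw [List.length_append, List.length_replicate]; omega

/-- Normalising a padded short message does nothing. [folklore] -/
theorem takeD_padMsg {mh : ℕ} {s : List Bool} (h : s.length ≤ mh) : (padMsg mh s).takeD mh false = padMsg mh s := by
  rw [List.takeD_eq_take _ (length_padMsg h).ge, List.take_of_length_le (length_padMsg h).le]

/-- The message is the prefix of its padding. [folklore] -/
theorem take_padMsg (mh : ℕ) (s : List Bool) : (padMsg mh s).take s.length = s := by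
  unfold padMsg; rw [List.take_left']; rfl

/-- Appending to a pair code extends its second component. [folklore] -/
theorem boolPair_append' (a b c : List Bool) : boolPair a b ++ c = boolPair a (b ++ c) := by
  simp [boolPair, List.append_assoc]

variable (M : OracleAlg Bool) (red : List Bool → CNF ℕ) (f : List Bool → ℕ) (x : List Bool) (ℓ D W R mh ma : ℕ)

/-- **The honest prover** ("Pat"): asked first (history of length `1`), the list of the TRUE oracle
answers of the accepting run of `M` (its free-running transcript of `ma` rounds); asked at a history
of length `2u + 3`, the fixed-width code of the honest polynomial `h` of instance `u / R`, round
`u % R`, at the challenges received so far — all padded to the common length. [cite: LundEtAl1992, §3 (proof of Thm. 1, (1): "a prover who truthfully answers all of Vanna's questions")]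
[cite: AroraBarakCC2009, Thm. 8.21 (proof: completeness, `s = h`)] -/
def honestProver : IPProver := fun hist =>
  if hist.length = 1 then padMsg mh (boolPair (encList (PRelSigma.trans M (Oracle.ofFun f) x ma)) [])
  else padMsg mh (encodeCoeffs W D
    (h (instOf M red x (ansOf hist) ((hist.length - 3) / 2 / R))
      (varList (instOf M red x (ansOf hist) ((hist.length - 3) / 2 / R)))
      (chals ℓ hist ((hist.length - 3) / 2 / R * R) ((hist.length - 3) / 2 % R))))

variable {M red f x ℓ D W R mh ma}

/-- The code of a list of strings of length `≤ B` has length `≤ |A| · (2B + 2)`. [folklore] -/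
theorem length_encList_le {A : List (List Bool)} {B : ℕ} (hA : ∀ a ∈ A, a.length ≤ B) : (encList A).length ≤ A.length * (2 * B + 2) := by
  induction A with
  | nil => simp
  | cons a A ih =>
    rw [encList_cons, length_boolPair, List.length_cons]
    have h1 := hA a (by simp)
    have h2 := ih fun b hb => hA b (by simp [hb])
    have h3 : (A.length + 1) * (2 * B + 2) = A.length * (2 * B + 2) + (2 * B + 2) := by ring
    omega

/-- Every answer in the free-running transcript is the oracle's answer to an earlier query. [folklore] -/
theorem exists_of_mem_trans {β : Type} (M : OracleAlg β) (O : Oracle) (x : List Bool) :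
    ∀ (k : ℕ) {a : List Bool}, a ∈ PRelSigma.trans M O x k → ∃ i < k, a = O (PRelSigma.qryOf M x (PRelSigma.trans M O x i))
  | 0, a, ha => by simp at ha
  | k + 1, a, ha => by
    rw [PRelSigma.trans_succ, List.mem_append, List.mem_singleton] at ha
    rcases ha with ha | rfl
    · obtain ⟨i, hi, h⟩ := exists_of_mem_trans M O x k ha
      exact ⟨i, by omega, h⟩
    · exact ⟨k, Nat.lt_succ_self k, rfl⟩

/-- The occurring variables are the listed ones, as a finset. [folklore] -/
theorem vars_eq_toFinset_varList (φ : CNF ℕ) : φ.vars = (varList φ).toFinset := by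
  ext v; rw [List.mem_toFinset, mem_varList_iff_mem_vars]

/-- `#SAT(φ) ≤ 2^{|encode φ|}`. [folklore] -/
theorem numSat_le_two_pow_length_encode (φ : CNF ℕ) : φ.numSat ≤ 2 ^ (encodingCNF.encode φ).length := by
  refine (CNF.numSat_le φ).trans (Nat.pow_le_pow_right (by norm_num) ?_)
  rw [vars_eq_toFinset_varList, List.toFinset_card_of_nodup (varList_nodup φ)]
  exact length_varList_le_length_encode φ

/-- **Deterministic completeness of the protocol**: against the honest prover the referee accepts the
public transcript on EVERY coin string, provided `M` with the oracle of `f` accepts `x` at round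
`ma < qn` with queries of length `≤ qn`, instances have code length `≤ N`, and the parameters satisfy
the arithmetic of the protocol. [cite: LundEtAl1992, §3 (proof of Thm. 1, (1): "Pr[Vanna accepts] = 1")]
[cite: AroraBarakCC2009, Thm. 8.21 (proof: completeness)] -/
theorem refCore_pubT_honestProver (hred : ∀ y, (red y).numSat = f y) {qn N k : ℕ}
    (hN : ∀ y : List Bool, y.length ≤ qn → (encodingCNF.encode (red y)).length ≤ N) (hma : ma < qn)
    (hsteps : ∀ i < ma, ∃ y, M.step x (PRelSigma.trans M (Oracle.ofFun f) x i) = Sum.inl y ∧ y.length ≤ qn)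
    (hfin : M.step x (PRelSigma.trans M (Oracle.ofFun f) x ma) = Sum.inr true)
    (hℓ : 1 ≤ ℓ) (hW : W = N + (ℓ + 3) * N + N + 2) (hD : D = N + 1) (hmh₁ : D * W ≤ mh)
    (hmh₂ : 2 * (qn * (2 * N + 4)) + 2 ≤ mh) (hk : 2 * (qn * N) + 5 ≤ k) (r : List Bool) :
    refCore M red ℓ D W N qn x (pubT mh r (honestProver M red f x ℓ D W N mh ma) k) = true := by
  set O := Oracle.ofFun f with hO
  set Ph := honestProver M red f x ℓ D W N mh ma with hPh
  set T := pubT mh r Ph k with hT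
  set A := PRelSigma.trans M O x ma with hA
  -- the queries of the accepting run and their lengths
  have hy : ∀ i < ma, (PRelSigma.qryOf M x (PRelSigma.trans M O x i)).length ≤ qn := fun i hi => by
    obtain ⟨y, hy, hyq⟩ := hsteps i hi
    rwa [PRelSigma.qryOf_eq_of_step_eq hy]
  -- the answers message fits
  have hAlen : (boolPair (encList A) []).length ≤ mh := by
    have hitem : ∀ a ∈ A, a.length ≤ N + 1 := fun a ha => by
      obtain ⟨i, hi, rfl⟩ := exists_of_mem_trans M O x ma ha
      rw [hO, Oracle.ofFun_apply, ← CodeFP.natE, CodeFP.length_natE]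
      refine Nat.size_le.2 (lt_of_le_of_lt ?_ (pow_lt_pow_right₀ (by norm_num : (1 : ℕ) < 2) (Nat.lt_succ_self N)))
      rw [← hred]
      exact (numSat_le_two_pow_length_encode _).trans (Nat.pow_le_pow_right (by norm_num) (hN _ (hy i hi)))
    have h1 := length_encList_le hitem
    rw [OracleCompose.length_trans] at h1
    rw [length_boolPair, List.length_nil]
    have h2 : ma * (2 * (N + 1) + 2) ≤ qn * (2 * N + 4) := by
      rw [show 2 * (N + 1) + 2 = 2 * N + 4 by ring]; exact Nat.mul_le_mul_right _ hma.le
    omega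
  -- (1) the first prover message carries the true answers
  have hans : ansOf T = A := by
    have h1 : T.getD 1 [] = padMsg mh (boolPair (encList A) []) := by
      rw [hT, getD_pubT mh r Ph (by omega : 1 < k), nextMsg, length_pubT, if_neg (by norm_num)]
      have : Ph (pubT mh r Ph 1) = padMsg mh (boolPair (encList A) []) := by
        rw [hPh, honestProver, length_pubT, if_pos rfl]
      rw [this, takeD_padMsg hAlen]
    unfold ansOf
    rw [h1, padMsg, boolPair_append', fstF_boolPair, decNil_encList]
  -- instances along the true answers
  have hinst : ∀ i < ma, instOf M red x (ansOf T) i = red (PRelSigma.qryOf M x (PRelSigma.trans M O x i)) := fun i hi => by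
    rw [hans, instOf, hA, OracleCompose.trans_take M O x hi.le]
  have hNi : ∀ i < ma, (encodingCNF.encode (instOf M red x (ansOf T) i)).length ≤ N := fun i hi => by
    rw [hinst i hi]; exact hN _ (hy i hi)
  -- (2) the polynomial messages are the honest ones
  have hmsg : ∀ i < ma, ∀ j < (varList (instOf M red x (ansOf T) i)).length,
      (polyMsg T (i * N + j)).take (D * W) =
        encodeCoeffs W D (h (instOf M red x (ansOf T) i) (varList (instOf M red x (ansOf T) i)) (chals ℓ T (i * N) j)) := by
    intro i hi j hj
    set φ := instOf M red x (ansOf T) i with hφ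
    have hjN : j < N := hj.trans_le ((length_varList_le_length_encode φ).trans (hNi i hi))
    have hNpos : 0 < N := by omega
    set u := i * N + j with hu
    have hui : u / N = i := by rw [hu, Nat.add_comm, Nat.add_mul_div_right _ _ hNpos, Nat.div_eq_of_lt hjN, Nat.zero_add]
    have huj : u % N = j := by rw [hu, Nat.add_comm, Nat.add_mul_mod_self_right, Nat.mod_eq_of_lt hjN]
    have huk : 2 * u + 3 < k := by
      have h1 : (i + 1) * N ≤ qn * N := Nat.mul_le_mul_right N (by omega)
      rw [Nat.succ_mul] at h1
      omega
    have hlenc : (encodeCoeffs W D (h φ (varList φ) (chals ℓ T (i * N) j))).length = D * W := length_encodeCoeffs (by omega) _ _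
    have hmsgu : polyMsg T u = padMsg mh (encodeCoeffs W D (h φ (varList φ) (chals ℓ T (i * N) j))) := by
      unfold polyMsg
      rw [hT, getD_pubT mh r Ph huk, nextMsg, length_pubT, if_neg (by omega)]
      have hhist : Ph (pubT mh r Ph (2 * u + 3)) = padMsg mh (encodeCoeffs W D (h φ (varList φ) (chals ℓ T (i * N) j))) := by
        rw [hPh, honestProver, length_pubT, if_neg (by omega), show (2 * u + 3 - 3) / 2 = u by omega, hui, huj,
          ← take_pubT mh r (honestProver M red f x ℓ D W N mh ma) huk.le, ← hT, ansOf_take (by omega), chals_take (by omega)]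
      rw [hhist, takeD_padMsg (by rw [hlenc]; exact hmh₁)]
    rw [hmsgu, ← hlenc, take_padMsg]
  exact refCore_of_honest hred hma.le hsteps hfin hℓ (le_of_eq hW.symm) (le_of_eq hD.symm) hans hNi hmsg

end Honest

/-! ### The protocol: soundness and completeness probabilities -/

section Protocol

variable {M : OracleAlg Bool} {red : List Bool → CNF ℕ} {f : List Bool → ℕ} {L : Language Bool} {x : List Bool}

/-- **The soundness estimate on the public transcript**: for `x ∉ L` the coin strings whose public
transcript the referee accepts have probability `≤ (k + 1) · N / 2^ℓ` (an accepted transcript has a bad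
coin block, `exists_badBlock_of_refCore`; fresh blocks and the union bound,
`uniformProb_exists_badBlock_le`; each bad set is small, `uniformProb_badSetIP_le`).
[cite: LundEtAl1992, §3 (proof of Thm. 1, (2))] [cite: AroraBarakCC2009, Thm. 8.21 (proof of the Claim)] -/
theorem uniformProb_refCore_le (hred : ∀ y, (red y).numSat = f y) {ℓ D W N qn k mh : ℕ}
    (hN : ∀ y : List Bool, y.length ≤ qn → (encodingCNF.encode (red y)).length ≤ N)
    (hrun : M.run (Oracle.ofFun f) qn x = some (L.boolIndicator x)) (hx : x ∉ L) (hk : 2 * (qn * N) + 5 ≤ k)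
    (hD : D = N + 1) (hℓ : ℓ ≤ mh) (P : IPProver) :
    uniformProb ((k + 1) * mh) {r | refCore M red ℓ D W N qn x (pubT mh r P k) = true} ≤ ((k + 1 : ℕ) : ℝ) * (N / 2 ^ ℓ) := by
  have hincl : {r : List Bool | refCore M red ℓ D W N qn x (pubT mh r P k) = true} ⊆
      {r | ∃ p < k + 1, (r.drop (p * mh)).take mh ∈ badSetIP M red x ℓ D W N N mh P p (r.take (p * mh))} := fun r hr => by
    rw [Set.mem_setOf_eq] at hr ⊢
    exact exists_badBlock_of_refCore hred hN hrun hx hk hD hr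
  refine (uniformProb_mono' hincl).trans ?_
  exact uniformProb_exists_badBlock_le (le_refl _) _ fun p _ w _ => uniformProb_badSetIP_le hℓ p w

variable (M red L) (q pr : Polynomial ℕ) (c n₀ : ℕ)

/-- **The verifier of the protocol** for the language decided by `M` with the oracle of `f`: the
public-coin verifier with `|x|^c` messages of length `m(|x|)` and the referee `Ref`.
[cite: LundEtAl1992, §3 (proof of Thm. 1)] -/
def lfknVerifier : IPVerifier := pubVerifier (Ref M red L q pr c n₀) (mPoly q pr c) c

variable {M red L q pr c n₀}

/-- The verifier is probabilistic polynomial time. [cite: LundEtAl1992, §2] -/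
theorem lfknVerifier_isPolyTime (hM : M.IsPolyTime encodingBoolBool) (hredC : CodeFP strE cnfE red) :
    (lfknVerifier M red L q pr c n₀).IsPolyTime :=
  pubVerifier_isPolyTime _ _ (Ref_mem_P hM hredC)

/-- Instances of queries of legal length have code length `≤ N(n)`. [folklore] -/
theorem length_encode_red_le (hpr : ∀ y : List Bool, (encodingCNF.encode (red y)).length ≤ pr.eval y.length) (n : ℕ)
    (y : List Bool) (hy : y.length ≤ q.eval n) : (encodingCNF.encode (red y)).length ≤ (Npoly q pr).eval n := by
  rw [eval_Npoly]
  exact (hpr y).trans (TM2Iter.eval_mono pr hy)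

/-- **Soundness of the protocol**: for `x ∉ L`, against every prover the verifier accepts with
probability `≤ 1/3` — on long inputs by `uniformProb_refCore_le` and `(n^c + 1) N / 2^ℓ ≤ 1/8`, on
short inputs because the referee decides `L` itself.
[cite: LundEtAl1992, §3 (proof of Thm. 1, (2): "the probability that a cheating prover can induce Vanna to erroneously accept is less than `N²` times the minuscule probability …")]
[cite: AroraBarakCC2009, Thm. 8.21 (proof: "`V` rejects with probability at least `(1 - d/p)ⁿ`")] -/
theorem acceptProb_le_third (hred : ∀ y, (red y).numSat = f y)
    (hpr : ∀ y : List Bool, (encodingCNF.encode (red y)).length ≤ pr.eval y.length)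
    (hrun : ∀ x : List Bool, M.run (Oracle.ofFun f) (q.eval x.length) x = some (L.boolIndicator x))
    (hn₀ : ∀ n, n₀ ≤ n → 2 * (q.eval n * (Npoly q pr).eval n) + 5 ≤ n ^ c)
    (hx : x ∉ L) (P : IPProver) :
    (lfknVerifier M red L q pr c n₀).acceptProb (x.length ^ c) x P ≤ 1 / 3 := by
  unfold IPVerifier.acceptProb lfknVerifier
  rw [pubVerifier_coins]
  by_cases hxn : n₀ ≤ x.length
  · have hset : {r : List Bool | (pubVerifier (Ref M red L q pr c n₀) (mPoly q pr c) c).Accepts (x.length ^ c) x r P} =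
        {r | refCore M red ((ellPoly q pr c).eval x.length) ((Dpoly q pr).eval x.length) ((Wpoly q pr c).eval x.length)
          ((Npoly q pr).eval x.length) (q.eval x.length) x (pubT ((mPoly q pr c).eval x.length) r P (x.length ^ c)) = true} :=
      Set.ext fun r => by
        rw [Set.mem_setOf_eq, Set.mem_setOf_eq]
        exact (accepts_iff _ _ _ r P _ x).trans (mem_Ref_iff_of_le hxn _)
    rw [hset]
    refine (uniformProb_refCore_le hred (length_encode_red_le hpr x.length) (hrun x) hx (hn₀ _ hxn) (eval_Dpoly q pr _)
      ?_ P).trans ?_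
    · rw [eval_mPoly]; omega
    · rw [eval_ellPoly]; exact soundness_numerics _ _
  · have hempty : {r : List Bool | (pubVerifier (Ref M red L q pr c n₀) (mPoly q pr c) c).Accepts (x.length ^ c) x r P} = ∅ :=
      Set.eq_empty_iff_forall_notMem.2 fun r hr => by
        rw [Set.mem_setOf_eq] at hr
        exact hx ((mem_Ref_iff_of_lt (M := M) (red := red) (L := L) (q := q) (pr := pr) (c := c) (Nat.not_le.1 hxn) _).1
          ((accepts_iff _ _ _ r P _ x).1 hr))
    rw [hempty, uniformProb_empty]
    norm_num

/-- **Completeness of the protocol**: for `x ∈ L` some prover (the honest one; on short inputs any) is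
accepted with probability `1`. [cite: LundEtAl1992, §3 (proof of Thm. 1, (1))] [cite: AroraBarakCC2009, Thm. 8.21 (proof: completeness)] -/
theorem exists_acceptProb_eq_one (hred : ∀ y, (red y).numSat = f y)
    (hpr : ∀ y : List Bool, (encodingCNF.encode (red y)).length ≤ pr.eval y.length)
    (hrun : ∀ x : List Bool, M.run (Oracle.ofFun f) (q.eval x.length) x = some (L.boolIndicator x))
    (hq : ∀ x : List Bool, ∀ y ∈ M.queries (Oracle.ofFun f) (q.eval x.length) x, y.length ≤ q.eval x.length)
    (hn₀ : ∀ n, n₀ ≤ n → 2 * (q.eval n * (Npoly q pr).eval n) + 5 ≤ n ^ c)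
    (hx : x ∈ L) :
    ∃ P : IPProver, (lfknVerifier M red L q pr c n₀).acceptProb (x.length ^ c) x P = 1 := by
  -- it suffices to accept on every coin string
  suffices h : ∃ P : IPProver, ∀ r : List Bool, (pubVerifier (Ref M red L q pr c n₀) (mPoly q pr c) c).Accepts (x.length ^ c) x r P by
    obtain ⟨P, hP⟩ := h
    refine ⟨P, ?_⟩
    unfold IPVerifier.acceptProb lfknVerifier
    have hset : {r : List Bool | (pubVerifier (Ref M red L q pr c n₀) (mPoly q pr c) c).Accepts (x.length ^ c) x r P} = Set.univ :=
      Set.eq_univ_iff_forall.2 fun r => by rw [Set.mem_setOf_eq]; exact hP r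
    rw [hset, uniformProb_univ]
  by_cases hxn : n₀ ≤ x.length
  · -- the accepting run of `M`
    obtain ⟨ma, hma, hall, hfin⟩ := (PRelSigma.run_eq_some_iff M (Oracle.ofFun f) (q.eval x.length) x _).1 (hrun x)
    rw [(Set.mem_iff_boolIndicator _ _).1 hx] at hfin
    have hsteps : ∀ i < ma, ∃ y, M.step x (PRelSigma.trans M (Oracle.ofFun f) x i) = Sum.inl y ∧ y.length ≤ q.eval x.length :=
      fun i hi => by
        obtain ⟨y, hy⟩ := hall i hi
        refine ⟨y, hy, hq x y ?_⟩
        have hmem := PRelSigma.mem_queries_of_trans M (Oracle.ofFun f) (q.eval x.length) x i (hi.trans hma)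
          fun i' hi' => hall i' (by omega)
        rwa [PRelSigma.qryOf_eq_of_step_eq hy] at hmem
    refine ⟨honestProver M red f x ((ellPoly q pr c).eval x.length) ((Dpoly q pr).eval x.length) ((Wpoly q pr c).eval x.length)
      ((Npoly q pr).eval x.length) ((mPoly q pr c).eval x.length) ma, fun r => ?_⟩
    rw [accepts_iff, mem_Ref_iff_of_le hxn]
    refine refCore_pubT_honestProver hred (length_encode_red_le hpr x.length) hma hsteps hfin ?_ (eval_Wpoly q pr c _)
      (eval_Dpoly q pr _) ?_ ?_ (hn₀ _ hxn) r
    · rw [eval_ellPoly]; omega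
    · rw [eval_mPoly]; exact Nat.le_add_right_of_le (Nat.le_add_right _ _)
    · rw [eval_mPoly, eval_Apoly]; omega
  · exact ⟨fun _ => [], fun r => by rw [accepts_iff, mem_Ref_iff_of_lt (Nat.not_le.1 hxn)]; exact hx⟩

end Protocol

/-! ### Assembly: `P^{#P} ⊆ IP` -/

/-- Every polynomial is eventually dominated by a power. [folklore] -/
theorem exists_pow_bound (p : Polynomial ℕ) : ∃ c : ℕ, 1 ≤ c ∧ ∃ n₀ : ℕ, ∀ n, n₀ ≤ n → p.eval n ≤ n ^ c := by
  obtain ⟨C, k, hC⟩ := exists_eval_le_mul_pow_add p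
  refine ⟨k + 1, by omega, 2 * C + 1, fun n hn => (hC n).trans ?_⟩
  have hnk : 1 ≤ n ^ k := Nat.one_le_pow _ _ (by omega)
  rw [pow_succ]
  nlinarith

/-- **`P^{#P} ⊆ IP` (Lund–Fortnow–Karloff–Nisan 1992, Theorem 1).** For `L ∈ P^f` with `f ∈ #P`
(`M` a polynomial-time oracle algorithm deciding `L` with the oracle of `f` within `q(|x|)` rounds):
reduce `f` parsimoniously to `#SAT` (`parsimoniousReducible_SHARPSAT`, Lemma 3's `#P`-complete
function), take the parameters of §`Params` and a power `n^c` dominating `2 q(n) N(n) + 5`, and run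
`lfknVerifier`; it is probabilistic polynomial time (`lfknVerifier_isPolyTime`), complete
(`exists_acceptProb_eq_one`) and sound (`acceptProb_le_third`). [cite: LundEtAl1992, Thm. 1 (p. 861), Lemma 3, §3]
[cite: AroraBarakCC2009, Thm. 8.21] -/
theorem PSharpP_subset_IP : PSharpP ⊆ IP := by
  intro L hL
  unfold PSharpP at hL
  simp only [Set.mem_iUnion, exists_prop] at hL
  obtain ⟨f, hf, M, hM, q, hMq⟩ := hL
  -- Lemma 3: the `#P`-complete function `#SAT`, reached parsimoniously
  obtain ⟨g, hg, hfg⟩ := parsimoniousReducible_SHARPSAT hf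
  have hred : ∀ y, (NegCNF.decCNF (g y)).numSat = f y := fun y => by
    rw [hfg y, Ladder3.SHARPSAT_eq_numSat_decCNF]
  have hcg : (KSATRed.canonCNFFn ∘ g) ∈ FP := comp_mem_FP KSATRed.canonCNFFn_mem_FP hg
  have hredC : CodeFP strE cnfE (fun y => NegCNF.decCNF (g y)) := of_fn (KSATRed.canonCNFFn ∘ g) hcg fun y => by
    rw [Function.comp_apply, KSATRed.canonCNFFn_eq, cnfE_eq]; rfl
  obtain ⟨pr, hpr⟩ := exists_poly_length_le_of_mem_FP hcg
  have hpr' : ∀ y : List Bool, (encodingCNF.encode (NegCNF.decCNF (g y))).length ≤ pr.eval y.length := fun y => by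
    have := hpr y
    rwa [Function.comp_apply, KSATRed.canonCNFFn_eq] at this
  -- the number of messages
  obtain ⟨c, hc, n₀, hn₀⟩ := exists_pow_bound (2 * (q * Npoly q pr) + 5)
  have hn₀' : ∀ n, n₀ ≤ n → 2 * (q.eval n * (Npoly q pr).eval n) + 5 ≤ n ^ c := fun n hn => by
    have := hn₀ n hn
    simpa using this
  refine IPRounds_pow_subset_IP hc ⟨lfknVerifier M (fun y => NegCNF.decCNF (g y)) L q pr c n₀,
    lfknVerifier_isPolyTime hM hredC, fun x => ⟨fun hx => ?_, fun hx P => ?_⟩⟩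
  · obtain ⟨P, hP⟩ := exists_acceptProb_eq_one hred hpr' (fun x => (hMq x).1) (fun x => (hMq x).2) hn₀' hx
    exact ⟨P, by rw [hP]; norm_num⟩
  · exact acceptProb_le_third hred hpr' (fun x => (hMq x).1) hn₀' hx P

end LFKN

/-- **Lund–Fortnow–Karloff–Nisan 1992, Theorem 1, discharged: `P^{#P} ⊆ IP`** over the tree's
classes (`LundEtAl1992_thm1`). Proof: `LFKN.PSharpP_subset_IP` — the public-coin sumcheck protocol
for the parsimonious `#SAT`-instances of the oracle queries of the `P^{#P}` machine, with the oracle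
answers supplied by the prover (Lemma 3). [cite: LundEtAl1992, Thm. 1 (p. 861), Lemma 3, §3]
[cite: AroraBarakCC2009, Thm. 8.21] -/
theorem LundEtAl1992_thm1_holds : LundEtAl1992_thm1 :=
  LFKN.PSharpP_subset_IP

end Literature.Computability.Complexity

end
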